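import Literature.MathematicalPhysics.QuantumLattice.HubbardHubbardModelEtaODLROProofs
import Literature.MathematicalPhysics.QuantumLattice.HubbardModelThermodynamicLimitProofs
import Literature.MathematicalPhysics.QuantumLattice.HubbardLocalSpinOperators
import HarnessLib

/-!
# η-pairing superconducting ground states of the generalized Hubbard model by the
# optimal-ground-state (bond Gershgorin) method (de Boer–Korepin–Schadschneider 1995,
# de Boer–Schadschneider 1995)

Topic `MathematicalPhysics/QuantumLattice` (family `hubbard`). Cell `pub/hubbard-cq`, seat
`hubbard-pc-lit-1` (transfer sources / positive-order certificates for PAIRING). WHAT THIS IS NOT: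
nothing is claimed for the plain Hubbard model (`X = V = Y = J = 0`), whose `η`-pairing states are
eigenstates (Yang 1989, tree `yang_etaPairing_eigenvector_holds`) but ground states only in the
trivial attractive corner covered below (`-U/Z ≥ 2|t|`); the models here are the GENERALIZED
(bond-charge `X = t`, pair-hopping `Y = ±2V`) nearest-neighbour Hubbard models of the sources, in
finite volume, at `T = 0`.

## The sources

* [dBKS] J. de Boer, V. E. Korepin, A. Schadschneider, *`η` pairing as a mechanism of
  superconductivity in models of strongly correlated electrons*, Phys. Rev. Lett. **74** (1995) 789
  (arXiv:cond-mat/9405035): for the general nearest-neighbour extension (their eq. (2)) of the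
  Hubbard model — bond-charge interaction `X`, nearest-neighbour Coulomb `V`, `XXZ` exchange
  `J_xy, J_z`, pair hopping `Y` (and three- and four-body terms `P, Q`, a field `h`) — the state `(η†)^N |0⟩`,
  `η† = Σ_j c†_{j↓} c†_{j↑}`, is an exact eigenstate iff `t = X`, `2V = Y` (their eq. (5)–(6)) and,
  by a Gerschgorin lower bound on the ground-state energy (their eq. (7)), a GROUND STATE as soon as
  `V ≤ 0` and `-U/Z ≥ max(2|t| + 2V, V - J_z/4, V + J_z/4 + |J_xy/2|)` (their eq. (8) at
  `P = Q = h = 0`), in every dimension; these states have off-diagonal long-range order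
  `⟨ψ_N | c†_{j↓} c†_{j↑} c_{l↑} c_{l↓} | ψ_N⟩ → (N/L)(1 - N/L)` (their eq. (4)), "and thus are
  superconducting".
* [dBS] J. de Boer, A. Schadschneider, *Exact ground states of generalized Hubbard models*,
  Phys. Rev. Lett. **75** (1995) 4298 (arXiv:cond-mat/9503122): the OPTIMAL GROUND STATE method.
  Write `H = Σ_{⟨jl⟩} h_{jl}` with the bond Hamiltonian (their eq. (1))
  `h_{jl} = -t Σ_σ (c†_{jσ} c_{lσ} + h.c.) + X Σ_σ (c†_{jσ} c_{lσ} + h.c.)(n_{j,-σ} + n_{l,-σ})`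
  `      + (U/Z)((n_{j↑}-½)(n_{j↓}-½) + (n_{l↑}-½)(n_{l↓}-½)) + V (n_j-1)(n_l-1)`
  `      + Y (c†_{j↑} c†_{j↓} c_{l↓} c_{l↑} + h.c.) + (J_xy/2)(S⁺_j S⁻_l + S⁺_l S⁻_j) + J_z S^z_j S^z_l`
  `      + (μ/Z)(n_j + n_l)`,
  `Z` the coordination number. The 16 local eigenstates (their eq. (2)) show that for `t = X`,
  `μ = 0` the local states `|00⟩, |22⟩, |20⟩ + |02⟩` out of which `(η†_{P=0})^N|0⟩` is built are
  local eigenstates with the common energy `E₀ = U/(2Z) + V` when `Y = 2V`, and that `E₀` is the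
  local ground-state energy iff `V ≤ 0`, `-U/Z ≥ max(2|t| + 2V, V - J_z/4, V + |J_xy|/2 + J_z/4)`
  (their eq. (9)); the momentum-`π` state (`η†_π = Σ_j (-1)^j c†_{j↓} c†_{j↑}`, built from
  `|00⟩, |22⟩, |20⟩ - |02⟩`) is optimal for `Y = -2V` under their eq. (10), which at `t = X`
  reduces to the same three inequalities.

## What is formalised (everything PROVED; no named fact, std axioms)

On a finite simple graph `G` on a linearly ordered site set `Λ` (every dimension, every lattice),
with real parameters `p = (t, X, U, V, Y, J_xy, J_z, μ, Z)`:

* §1 `re_quadForm_ge_gershgorin` — the Gerschgorin mechanism of [dBKS, eq. (7)] in quadratic-form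
  (operator-inequality) form: for a Hermitian matrix `A`,
  `Re ⟨ψ, A ψ⟩ ≥ Σ_α (Re A_αα - Σ_{β ≠ α} |A_βα|) |ψ_α|²`.
* §2 `GenHubbard.bondHamiltonian p j l` = the displayed `h_{jl}` [dBS, eq. (1)] in the tree's
  Fock-space vocabulary (`creation`, `annihilation`, `numberOp`, `fermionSpinPlus/Minus/Z`);
  `GenHubbard.hamiltonian G p = Σ_{j < l, j ∼ l} h_{jl}`.
* §3 the action of every term of `h_{jl}` on occupation-basis vectors; §4 the bond Gerschgorin
  data: `(h_{jl})_{αα} = diagVal` and `Σ_{β ≠ α} |(h_{jl})_{βα}| ≤ offBound`, functions of the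
  four occupation numbers of `α` at the bond, and the sixteen-configuration certificate
  `diagVal - offBound ≥ U/(2Z) + V` under [dBS, eq. (9)] (`localGershgorin_ge`); hence the
  OPERATOR inequality `Re ⟨φ, h_{jl} φ⟩ ≥ (U/(2Z) + V) ‖φ‖²` (`bondHamiltonian_re_expect_ge`) and
  `Re ⟨φ, H φ⟩ ≥ #bonds · (U/(2Z) + V) ‖φ‖²` (`hamiltonian_re_expect_ge`).
* §5 `bondHamiltonian_mulVec_etaPairingState` — for `t = X`, `μ = 0` and a sign function `ε`
  with `Y ε_j ε_l = 2V` on the bond, `h_{jl} (η†_ε)^N |0⟩ = (U/(2Z) + V) (η†_ε)^N |0⟩`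
  (`ε ≡ 1`: `Y = 2V`, momentum `0`; `ε` a bipartite sign: `Y = -2V`, momentum `π`).
* §6 THE THEOREM [dBKS, eq. (8); dBS, eq. (9)] `etaPairing_isGroundState`: under `t = X`,
  `Y ε_j ε_l = 2V` on every bond, `μ = 0`, `V ≤ 0`, `-U/Z ≥ 2|t| + 2V`, `-U/Z ≥ V - J_z/4`,
  `-U/Z ≥ V + |J_xy|/2 + J_z/4`, for every `N ≤ |Λ|` the `η`-pairing state `(η†_ε)^N |0⟩` is a
  ground state of `H` in the `2N`-particle sector, with sector ground energy
  `#bonds · (U/(2Z) + V)` — the same for all `N` (the `η`-multiplet); its off-diagonal long-range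
  order is the tree's `pairAmplitude_etaPairingState`:
  `⟨ψ_N, c†_{x↑} c†_{x↓} c_{y↓} c_{y↑} ψ_N⟩ = ε_x ε_y N(M-N)/(M(M-1)) ‖ψ_N‖²`, `x ≠ y`, `M = |Λ|`
  (`etaPairing_groundState_ODLRO`, [dBKS, eq. (4)]); the momentum-`0` (`ε ≡ 1`, `Y = 2V`) and
  momentum-`π` (bipartite `ε`, `Y = -2V`) specialisations are `etaPairing_isGroundState_momentumZero`
  / `_momentumPi`. On a `Z`-regular graph the on-site part of `H` is the Hubbard interaction
  `U Σ_x (n_{x↑}-½)(n_{x↓}-½)` (`sum_bond_onSite_eq`), and a chemical potential only shifts sector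
  energies (`re_expect_add_chemicalPotential`).

PC/CQ pricing (cell `pub/hubbard-cq`): the mechanism is a FINITE local certificate (sixteen bond
configurations) turning into a volume-uniform statement (exact ground state + ODLRO of order
`n(1-n)`), i.e. the printed precedent against which «reduction-to-finite» positive-order cards are
priced; it needs the frustration-free structure `t = X` (conservation of the number of doubly
occupied sites), not reflection positivity.
-/

noncomputable section

namespace Literature.MathematicalPhysics.QuantumLattice

open Matrix Finset HubbardWave0
open scoped ComplexOrder

/-! ## §1 The Gerschgorin mechanism in quadratic-form form -/

section Gershgorin

variable {n : Type*} [Fintype n] [DecidableEq n]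

/-- `Re (conj z · a · w) ≥ -‖a‖ (‖z‖² + ‖w‖²)/2`. [folklore] -/
private theorem re_star_mul_mul_ge (z a w : ℂ) :
    -(‖a‖ * ((‖z‖ ^ 2 + ‖w‖ ^ 2) / 2)) ≤ (star z * a * w).re := by
  have h1 : |(star z * a * w).re| ≤ ‖star z * a * w‖ := Complex.abs_re_le_norm _
  have h2 : ‖star z * a * w‖ = ‖a‖ * (‖z‖ * ‖w‖) := by
    rw [norm_mul, norm_mul, norm_star]; ring
  have h3 : ‖z‖ * ‖w‖ ≤ (‖z‖ ^ 2 + ‖w‖ ^ 2) / 2 := by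
    nlinarith [sq_nonneg (‖z‖ - ‖w‖), norm_nonneg z, norm_nonneg w]
  have h4 : ‖a‖ * (‖z‖ * ‖w‖) ≤ ‖a‖ * ((‖z‖ ^ 2 + ‖w‖ ^ 2) / 2) :=
    mul_le_mul_of_nonneg_left h3 (norm_nonneg a)
  have := (abs_le.1 h1).1
  linarith

/-- **Gerschgorin's theorem in quadratic-form form** (the lower-bound mechanism of
de Boer–Korepin–Schadschneider, PRL 74 (1995) 789, eq. (7): `E₀ ≥ min_α (⟨ψ_α|H|ψ_α⟩ -
Σ_{β ≠ α} |⟨ψ_β|H|ψ_α⟩|)`, here as an operator inequality valid for every vector): for a Hermitian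
matrix `A` and every `ψ`,
`Σ_α (Re A_αα - Σ_{β ≠ α} ‖A_βα‖) ‖ψ_α‖² ≤ Re ⟨ψ, A ψ⟩`.
[cite: deBoerKorepinSchadschneider1995, eq. (7)] -/
theorem re_quadForm_ge_gershgorin {A : Matrix n n ℂ} (hA : A.IsHermitian) (ψ : n → ℂ) :
    ∑ a, ((A a a).re - ∑ b ∈ univ.erase a, ‖A b a‖) * ‖ψ a‖ ^ 2 ≤
      (star ψ ⬝ᵥ (A *ᵥ ψ)).re := by
  classical
  -- expand the quadratic form
  have hexp : star ψ ⬝ᵥ (A *ᵥ ψ) = ∑ a, ∑ b, star (ψ a) * A a b * ψ b := by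
    simp only [dotProduct, mulVec, Pi.star_apply, Finset.mul_sum, mul_assoc]
  have hdiag : ∀ a, (star (ψ a) * A a a * ψ a).re = (A a a).re * ‖ψ a‖ ^ 2 := by
    intro a
    have : star (ψ a) * A a a * ψ a = A a a * ((‖ψ a‖ ^ 2 : ℝ) : ℂ) := by
      rw [mul_comm (star (ψ a)), mul_assoc, Complex.star_def, mul_comm (starRingEnd ℂ (ψ a)),
        Complex.mul_conj, Complex.normSq_eq_norm_sq]
    rw [this, Complex.re_mul_ofReal]
  have hsym : ∀ a b, ‖A a b‖ = ‖A b a‖ := by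
    intro a b
    rw [← hA.apply a b, norm_star]
  rw [hexp, Complex.re_sum]
  simp_rw [Complex.re_sum]
  -- split off the diagonal
  have hsplit : ∀ a, ∑ b, (star (ψ a) * A a b * ψ b).re =
      (A a a).re * ‖ψ a‖ ^ 2 + ∑ b ∈ univ.erase a, (star (ψ a) * A a b * ψ b).re := by
    intro a
    rw [← Finset.add_sum_erase _ _ (mem_univ a), hdiag]
  simp_rw [hsplit]
  rw [Finset.sum_add_distrib]
  -- bound the off-diagonal part
  have hoff : ∀ a, -(∑ b ∈ univ.erase a, ‖A a b‖ * ((‖ψ a‖ ^ 2 + ‖ψ b‖ ^ 2) / 2)) ≤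
      ∑ b ∈ univ.erase a, (star (ψ a) * A a b * ψ b).re := by
    intro a
    rw [← Finset.sum_neg_distrib]
    exact Finset.sum_le_sum fun b _ => re_star_mul_mul_ge (ψ a) (A a b) (ψ b)
  have hoff' : -(∑ a, ∑ b ∈ univ.erase a, ‖A a b‖ * ((‖ψ a‖ ^ 2 + ‖ψ b‖ ^ 2) / 2)) ≤
      ∑ a, ∑ b ∈ univ.erase a, (star (ψ a) * A a b * ψ b).re := by
    rw [← Finset.sum_neg_distrib]
    exact Finset.sum_le_sum fun a _ => hoff a
  -- resum the symmetric bound: Σ_a Σ_{b≠a} ‖A a b‖ (‖ψ a‖² + ‖ψ b‖²)/2 = Σ_a ‖ψ a‖² Σ_{b≠a} ‖A b a‖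
  have hresum : ∑ a, ∑ b ∈ univ.erase a, ‖A a b‖ * ((‖ψ a‖ ^ 2 + ‖ψ b‖ ^ 2) / 2) =
      ∑ a, (∑ b ∈ univ.erase a, ‖A b a‖) * ‖ψ a‖ ^ 2 := by
    have h1 : ∀ a, ∑ b ∈ univ.erase a, ‖A a b‖ * ((‖ψ a‖ ^ 2 + ‖ψ b‖ ^ 2) / 2) =
        (∑ b ∈ univ.erase a, ‖A a b‖ * ‖ψ a‖ ^ 2) / 2 +
          (∑ b ∈ univ.erase a, ‖A a b‖ * ‖ψ b‖ ^ 2) / 2 := by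
      intro a
      rw [Finset.sum_div, Finset.sum_div, ← Finset.sum_add_distrib]
      exact Finset.sum_congr rfl fun b _ => by ring
    simp_rw [h1]
    rw [Finset.sum_add_distrib]
    -- the second double sum equals the first after swapping the summation order
    have hswap : ∑ a, (∑ b ∈ univ.erase a, ‖A a b‖ * ‖ψ b‖ ^ 2) / 2 =
        ∑ b, (∑ a ∈ univ.erase b, ‖A a b‖ * ‖ψ b‖ ^ 2) / 2 := by
      rw [← Finset.sum_div, ← Finset.sum_div]
      congr 1
      have key : ∀ (f : n → n → ℝ), ∑ a, ∑ b ∈ univ.erase a, f a b =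
          ∑ b, ∑ a ∈ univ.erase b, f a b := by
        intro f
        have h2 : ∀ a, ∑ b ∈ univ.erase a, f a b = ∑ b, if b = a then 0 else f a b := by
          intro a
          rw [← Finset.sum_erase_add _ _ (mem_univ a), if_pos rfl, add_zero]
          exact Finset.sum_congr rfl fun b hb => by rw [if_neg (ne_of_mem_erase hb)]
        have h3 : ∀ b, ∑ a ∈ univ.erase b, f a b = ∑ a, if b = a then 0 else f a b := by
          intro b
          rw [← Finset.sum_erase_add _ _ (mem_univ b), if_pos rfl, add_zero]
          exact Finset.sum_congr rfl fun a ha => by rw [if_neg (ne_of_mem_erase ha).symm]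
        simp_rw [h2, h3]
        exact Finset.sum_comm
      exact key _
    rw [hswap]
    have h4 : ∀ b, (∑ a ∈ univ.erase b, ‖A a b‖ * ‖ψ b‖ ^ 2) / 2 =
        (∑ a ∈ univ.erase b, ‖A a b‖) * ‖ψ b‖ ^ 2 / 2 := by
      intro b; rw [Finset.sum_mul]
    have h5 : ∀ a, (∑ b ∈ univ.erase a, ‖A a b‖ * ‖ψ a‖ ^ 2) / 2 =
        (∑ b ∈ univ.erase a, ‖A b a‖) * ‖ψ a‖ ^ 2 / 2 := by
      intro a
      rw [Finset.sum_mul]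
      congr 1
      exact Finset.sum_congr rfl fun b _ => by rw [hsym]
    simp_rw [h4, h5]
    rw [← Finset.sum_add_distrib]
    exact Finset.sum_congr rfl fun a _ => by ring
  rw [hresum] at hoff'
  have hfinal : ∑ a, ((A a a).re - ∑ b ∈ univ.erase a, ‖A b a‖) * ‖ψ a‖ ^ 2 =
      ∑ a, (A a a).re * ‖ψ a‖ ^ 2 - ∑ a, (∑ b ∈ univ.erase a, ‖A b a‖) * ‖ψ a‖ ^ 2 := by
    rw [← Finset.sum_sub_distrib]
    exact Finset.sum_congr rfl fun a _ => by ring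
  rw [hfinal]
  linarith

/-- Corollary: a uniform lower bound `c ≤ Re A_αα - Σ_{β ≠ α} ‖A_βα‖` on the Gerschgorin data of a
Hermitian matrix is an operator lower bound, `c ‖ψ‖² ≤ Re ⟨ψ, A ψ⟩`.
[cite: deBoerKorepinSchadschneider1995, eq. (7)] -/
theorem re_quadForm_ge_of_gershgorin_ge {A : Matrix n n ℂ} (hA : A.IsHermitian) {c : ℝ}
    (hc : ∀ a, c ≤ (A a a).re - ∑ b ∈ univ.erase a, ‖A b a‖) (ψ : n → ℂ) :
    c * ∑ a, ‖ψ a‖ ^ 2 ≤ (star ψ ⬝ᵥ (A *ᵥ ψ)).re := by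
  refine le_trans ?_ (re_quadForm_ge_gershgorin hA ψ)
  rw [Finset.mul_sum]
  exact Finset.sum_le_sum fun a _ => mul_le_mul_of_nonneg_right (hc a) (sq_nonneg _)

omit [DecidableEq n] in
/-- `Re ⟨ψ, ψ⟩ = Σ_α ‖ψ_α‖²`. [folklore] -/
private theorem re_star_dotProduct_self_eq_sum_sq (ψ : n → ℂ) :
    (star ψ ⬝ᵥ ψ).re = ∑ a, ‖ψ a‖ ^ 2 := by
  simp only [dotProduct, Pi.star_apply, Complex.re_sum]
  refine Finset.sum_congr rfl fun a _ => ?_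
  rw [Complex.star_def, Complex.conj_mul', ← Complex.ofReal_pow, Complex.ofReal_re]

end Gershgorin

/-! ## §2 The generalized Hubbard bond Hamiltonian of de Boer–Schadschneider -/

namespace GenHubbard

variable {Λ : Type*} [LinearOrder Λ] [Fintype Λ]

/-- The nine real parameters of the generalized nearest-neighbour Hubbard bond Hamiltonian of
de Boer–Schadschneider, PRL 75 (1995) 4298, eq. (1): hopping `t`, bond-charge interaction `X`,
on-site interaction `U`, nearest-neighbour Coulomb interaction `V`, pair hopping `Y`, `XXZ`
exchange constants `J_xy`, `J_z`, chemical potential `μ`, and the coordination number `Z` by which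
the on-site terms are shared among the bonds. [cite: deBoerSchadschneider1995, eq. (1)] -/
structure Params where
  /-- hopping amplitude `t` -/
  t : ℝ
  /-- bond-charge interaction `X` -/
  X : ℝ
  /-- on-site (Hubbard) interaction `U` -/
  U : ℝ
  /-- nearest-neighbour Coulomb interaction `V` -/
  V : ℝ
  /-- pair-hopping amplitude `Y` -/
  Y : ℝ
  /-- transverse exchange `J_xy` -/
  Jxy : ℝ
  /-- longitudinal exchange `J_z` -/
  Jz : ℝ
  /-- chemical potential `μ` -/
  μ : ℝ
  /-- coordination number `Z` (the on-site terms enter each bond with weight `1/Z`) -/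
  Z : ℝ

/-- The on-site pair creation operator `c†_{x↑} c†_{x↓}` (the summand of Yang's `η†`, tree
`etaRaise`). [cite: deBoerSchadschneider1995, eq. (1)] -/
def pairCre (x : Λ) : Matrix (Finset (Orb Λ)) (Finset (Orb Λ)) ℂ :=
  creation (orb x 0) * creation (orb x 1)

/-- The on-site pair annihilation operator `c_{x↓} c_{x↑} = (c†_{x↑} c†_{x↓})†`.
[cite: deBoerSchadschneider1995, eq. (1)] -/
def pairAnn (x : Λ) : Matrix (Finset (Orb Λ)) (Finset (Orb Λ)) ℂ :=
  annihilation (orb x 1) * annihilation (orb x 0)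

/-- The site occupation `n_x = n_{x↑} + n_{x↓}`. [cite: deBoerSchadschneider1995, eq. (1)] -/
def siteNumber (x : Λ) : Matrix (Finset (Orb Λ)) (Finset (Orb Λ)) ℂ :=
  numberOp x 0 + numberOp x 1

/-- The particle–hole symmetric on-site interaction `(n_{x↑} - ½)(n_{x↓} - ½)`.
[cite: deBoerSchadschneider1995, eq. (1)] -/
def onSiteQ (x : Λ) : Matrix (Finset (Orb Λ)) (Finset (Orb Λ)) ℂ :=
  (numberOp x 0 - (1 / 2 : ℂ) • 1) * (numberOp x 1 - (1 / 2 : ℂ) • 1)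

/-- The spin index `-σ`. [folklore] -/
def flipSpin (σ : Fin 2) : Fin 2 := 1 - σ

/-- The correlated-hopping factor `-t + X (n_{j,-σ} + n_{l,-σ})` multiplying `c†_{jσ} c_{lσ}`
(hopping plus bond-charge interaction). [cite: deBoerSchadschneider1995, eq. (1)] -/
def hopFactor (p : Params) (j l : Λ) (σ : Fin 2) : Matrix (Finset (Orb Λ)) (Finset (Orb Λ)) ℂ :=
  (-(p.t : ℂ)) • 1 + (p.X : ℂ) • (numberOp j (flipSpin σ) + numberOp l (flipSpin σ))

/-- **The generalized Hubbard bond Hamiltonian** of de Boer–Schadschneider, PRL 75 (1995) 4298,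
eq. (1), on the bond `{j, l}`:
`h_{jl} = -t Σ_σ (c†_{jσ} c_{lσ} + c†_{lσ} c_{jσ}) + X Σ_σ (c†_{jσ} c_{lσ} + c†_{lσ} c_{jσ})(n_{j,-σ} + n_{l,-σ})`
`  + (U/Z)((n_{j↑}-½)(n_{j↓}-½) + (n_{l↑}-½)(n_{l↓}-½)) + V (n_j - 1)(n_l - 1)`
`  + Y (c†_{j↑} c†_{j↓} c_{l↓} c_{l↑} + c†_{l↑} c†_{l↓} c_{j↓} c_{j↑})`
`  + (J_xy/2)(S⁺_j S⁻_l + S⁺_l S⁻_j) + J_z S^z_j S^z_l + (μ/Z)(n_j + n_l)`.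
The hopping and bond-charge terms are written together as
`Σ_σ (c†_{jσ} c_{lσ} + c†_{lσ} c_{jσ}) (-t + X (n_{j,-σ} + n_{l,-σ}))` (the densities of the
opposite spin commute with the hopping of spin `σ`). [cite: deBoerSchadschneider1995, eq. (1)] -/
def bondHamiltonian (p : Params) (j l : Λ) : Matrix (Finset (Orb Λ)) (Finset (Orb Λ)) ℂ :=
  (∑ σ : Fin 2,
      (creation (orb j σ) * annihilation (orb l σ) + creation (orb l σ) * annihilation (orb j σ)) *
        hopFactor p j l σ) +
    ((p.U / p.Z : ℝ) : ℂ) • (onSiteQ j + onSiteQ l) +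
    (p.V : ℂ) • ((siteNumber j - 1) * (siteNumber l - 1)) +
    (p.Y : ℂ) • (pairCre j * pairAnn l + pairCre l * pairAnn j) +
    ((p.Jxy / 2 : ℝ) : ℂ) • (fermionSpinPlus j * fermionSpinMinus l +
      fermionSpinPlus l * fermionSpinMinus j) +
    (p.Jz : ℂ) • (fermionSpinZ j * fermionSpinZ l) +
    ((p.μ / p.Z : ℝ) : ℂ) • (siteNumber j + siteNumber l)

variable (G : SimpleGraph Λ) [DecidableRel G.Adj]

/-- **The generalized Hubbard Hamiltonian** `H = Σ_{⟨jl⟩} h_{jl}`, the sum of the bond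
Hamiltonians over the (unordered) edges `j < l`, `j ∼ l` of a finite simple graph.
[cite: deBoerSchadschneider1995, eq. (1)] -/
def hamiltonian (p : Params) : Matrix (Finset (Orb Λ)) (Finset (Orb Λ)) ℂ :=
  ∑ j : Λ, ∑ l : Λ, if j < l ∧ G.Adj j l then bondHamiltonian p j l else 0

/-- The number of bonds (edges `j < l`, `j ∼ l`). [folklore] -/
def bondCount : ℕ := ((univ : Finset (Λ × Λ)).filter fun e => e.1 < e.2 ∧ G.Adj e.1 e.2).card

/-- The local ground-state energy `E₀ = U/(2Z) + V` of the bond Hamiltonian in the `η`-pairing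
regime (de Boer–Schadschneider, PRL 75 (1995) 4298: `E₀ = E₁ = E₆^{(-)} = E₈ = U/2Z + V`).
[cite: deBoerSchadschneider1995, eq. (2) and the line before eq. (9)] -/
def localEnergy (p : Params) : ℝ := p.U / (2 * p.Z) + p.V

/-- **The optimal-ground-state inequalities for the `η`-pairing states** (de Boer–Schadschneider,
PRL 75 (1995) 4298, eq. (9); de Boer–Korepin–Schadschneider, PRL 74 (1995) 789, eq. (8) at
`P = Q = h = 0`): `V ≤ 0` and `-U/Z ≥ max(2|t| + 2V, V - J_z/4, V + |J_xy|/2 + J_z/4)`.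
[cite: deBoerSchadschneider1995, eq. (9)] -/
structure OGSInequalities (p : Params) : Prop where
  hV : p.V ≤ 0
  hop : 2 * |p.t| + 2 * p.V ≤ -(p.U / p.Z)
  ferro : p.V - p.Jz / 4 ≤ -(p.U / p.Z)
  flip : p.V + |p.Jxy| / 2 + p.Jz / 4 ≤ -(p.U / p.Z)

/-! ## §3 Structure of the bond Hamiltonian: diagonal part, moves, hermiticity -/

section Structure

variable {Λ : Type*} [LinearOrder Λ] [Fintype Λ]

/-- `-σ` unfolded: `flipSpin 0 = 1`. [cite: deBoerSchadschneider1995, eq. (1)] -/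
@[simp] theorem flipSpin_zero : flipSpin 0 = 1 := by decide

/-- `-σ` unfolded: `flipSpin 1 = 0`. [cite: deBoerSchadschneider1995, eq. (1)] -/
@[simp] theorem flipSpin_one : flipSpin 1 = 0 := by decide

/-- `-σ ≠ σ`. [cite: deBoerSchadschneider1995, eq. (1)] -/
theorem flipSpin_ne (σ : Fin 2) : flipSpin σ ≠ σ := by
  fin_cases σ <;> decide

/-- The occupation number `[i ∈ α] ∈ {0, 1}` of the orbital `i` in the configuration `α`.
[folklore] -/
def occ (α : Finset (Orb Λ)) (i : Orb Λ) : ℝ := if i ∈ α then 1 else 0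

omit [Fintype Λ] in
/-- `occ` is `0` or `1`. [cite: deBoerSchadschneider1995, eq. (2)] -/
theorem occ_eq_zero_or_one (α : Finset (Orb Λ)) (i : Orb Λ) : occ α i = 0 ∨ occ α i = 1 := by
  unfold occ; split_ifs <;> simp

omit [Fintype Λ] in
/-- Occupied orbitals have occupation number `1`. [cite: deBoerSchadschneider1995, eq. (2)] -/
theorem occ_of_mem {α : Finset (Orb Λ)} {i : Orb Λ} (h : i ∈ α) : occ α i = 1 := if_pos h

omit [Fintype Λ] in
/-- Empty orbitals have occupation number `0`. [cite: deBoerSchadschneider1995, eq. (2)] -/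
theorem occ_of_not_mem {α : Finset (Orb Λ)} {i : Orb Λ} (h : i ∉ α) : occ α i = 0 := if_neg h

/-- `n_{xσ}` is the diagonal matrix of occupation numbers. [cite: Tasaki2020, §9.2] -/
theorem numberOp_eq_diagonal (x : Λ) (σ : Fin 2) :
    numberOp x σ = diagonal fun α : Finset (Orb Λ) => ((occ α (orb x σ) : ℝ) : ℂ) := by
  rw [show numberOp x σ = numberAt (orb x σ) from rfl, numberAt_eq_diagonal]
  congr 1
  funext α
  unfold occ
  split_ifs <;> simp

omit [Fintype Λ] in
/-- `c • 1` is diagonal. [folklore] -/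
private theorem smul_one_eq_diagonal' (c : ℂ) :
    c • (1 : Matrix (Finset (Orb Λ)) (Finset (Orb Λ)) ℂ) = diagonal fun _ => c := by
  rw [← diagonal_one, ← diagonal_smul]
  congr 1
  funext α
  simp

/-- The diagonal (density–density, Ising and chemical-potential) part of the bond Hamiltonian.
[cite: deBoerSchadschneider1995, eq. (1)] -/
def diagOp (p : Params) (j l : Λ) : Matrix (Finset (Orb Λ)) (Finset (Orb Λ)) ℂ :=
  ((p.U / p.Z : ℝ) : ℂ) • (onSiteQ j + onSiteQ l) +
    (p.V : ℂ) • ((siteNumber j - 1) * (siteNumber l - 1)) +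
    (p.Jz : ℂ) • (fermionSpinZ j * fermionSpinZ l) +
    ((p.μ / p.Z : ℝ) : ℂ) • (siteNumber j + siteNumber l)

/-- The value of the diagonal part on a configuration with bond occupation numbers
`a = [j↑], b = [j↓], c = [l↑], d = [l↓]`:
`(U/Z)((a-½)(b-½) + (c-½)(d-½)) + V (a+b-1)(c+d-1) + (J_z/4)(a-b)(c-d) + (μ/Z)(a+b+c+d)`.
[cite: deBoerSchadschneider1995, eq. (2)] -/
def diagFormula (p : Params) (a b c d : ℝ) : ℝ :=
  p.U / p.Z * ((a - 1 / 2) * (b - 1 / 2) + (c - 1 / 2) * (d - 1 / 2)) +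
    p.V * ((a + b - 1) * (c + d - 1)) + p.Jz / 4 * ((a - b) * (c - d)) +
    p.μ / p.Z * (a + b + c + d)

/-- The diagonal entry of `h_{jl}` at the configuration `α`. [cite: deBoerSchadschneider1995, eq. (2)] -/
def diagVal (p : Params) (j l : Λ) (α : Finset (Orb Λ)) : ℝ :=
  diagFormula p (occ α (orb j 0)) (occ α (orb j 1)) (occ α (orb l 0)) (occ α (orb l 1))

/-- The diagonal part IS a diagonal matrix, with entries `diagVal`. [cite: deBoerSchadschneider1995, eq. (2)] -/
theorem diagOp_eq_diagonal (p : Params) (j l : Λ) :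
    diagOp p j l = diagonal fun α => ((diagVal p j l α : ℝ) : ℂ) := by
  simp only [diagOp, onSiteQ, siteNumber, fermionSpinZ, numberOp_eq_diagonal,
    ← diagonal_one, diagonal_add, diagonal_sub, diagonal_mul_diagonal, ← diagonal_smul]
  congr 1
  funext α
  simp only [Pi.smul_apply, smul_eq_mul, diagVal, diagFormula]
  push_cast
  ring

/-- The correlated-hopping factor is diagonal: `-t + X ([j,-σ] + [l,-σ])`.
[cite: deBoerSchadschneider1995, eq. (1)] -/
theorem hopFactor_eq_diagonal (p : Params) (j l : Λ) (σ : Fin 2) :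
    hopFactor p j l σ = diagonal fun α =>
      ((-p.t + p.X * (occ α (orb j (flipSpin σ)) + occ α (orb l (flipSpin σ))) : ℝ) : ℂ) := by
  simp only [hopFactor, numberOp_eq_diagonal, smul_one_eq_diagonal', diagonal_add, ← diagonal_smul]
  congr 1
  funext α
  simp only [Pi.smul_apply, smul_eq_mul]
  push_cast
  ring

/-- The bond Hamiltonian split into its diagonal part and eight elementary moves (two hopping
directions per spin, two pair hops, two spin flips). [cite: deBoerSchadschneider1995, eq. (1)] -/
theorem bondHamiltonian_eq (p : Params) (j l : Λ) :
    bondHamiltonian p j l =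
      (∑ σ : Fin 2, (creation (orb j σ) * annihilation (orb l σ) * hopFactor p j l σ +
          creation (orb l σ) * annihilation (orb j σ) * hopFactor p j l σ)) +
        diagOp p j l +
        ((p.Y : ℂ) • (pairCre j * pairAnn l) + (p.Y : ℂ) • (pairCre l * pairAnn j)) +
        (((p.Jxy / 2 : ℝ) : ℂ) • (fermionSpinPlus j * fermionSpinMinus l) +
          ((p.Jxy / 2 : ℝ) : ℂ) • (fermionSpinPlus l * fermionSpinMinus j)) := by
  simp only [bondHamiltonian, diagOp, add_mul, smul_add, Finset.sum_add_distrib]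
  abel

/-! ### Hermiticity -/

/-- `(c†_a c_b)† = c†_b c_a`. [cite: Tasaki2020, §9.2] -/
theorem conjTranspose_creation_mul_annihilation (a b : Orb Λ) :
    (creation a * annihilation b)ᴴ = creation b * annihilation a := by
  rw [conjTranspose_mul, annihilation_conjTranspose, creation_conjTranspose]

/-- `n_a` commutes with `c_p` for `a ≠ p`. [cite: EsslerEtAl2005, §2.1 eq. (2.8)] -/
theorem numberAt_mul_annihilation_of_ne' {a p : Orb Λ} (h : a ≠ p) :
    numberAt a * annihilation p = annihilation p * numberAt a := by
  have h1 := congrArg conjTranspose (number_mul_creation_of_ne (ι := Orb Λ) h)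
  simp only [conjTranspose_mul, creation_conjTranspose, annihilation_conjTranspose] at h1
  rw [numberAt, ← mul_assoc, ← h1, mul_assoc]

/-- `n_a` commutes with the hopping `c†_p c_q` when `a ∉ {p, q}`. [cite: EsslerEtAl2005, §2.1 eq. (2.8)] -/
theorem numberAt_commute_hop {a p q : Orb Λ} (hp : a ≠ p) (hq : a ≠ q) :
    numberAt a * (creation p * annihilation q) = creation p * annihilation q * numberAt a := by
  rw [← mul_assoc, numberAt, number_mul_creation_of_ne hp, mul_assoc, ← numberAt,
    numberAt_mul_annihilation_of_ne' hq, ← mul_assoc]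

/-- The correlated-hopping factor commutes with the hopping of spin `σ` (it only involves the
densities of spin `-σ`). [cite: deBoerSchadschneider1995, eq. (1)] -/
theorem hopFactor_commute_hop (p : Params) (j l x y : Λ) (σ : Fin 2) :
    hopFactor p j l σ * (creation (orb x σ) * annihilation (orb y σ)) =
      creation (orb x σ) * annihilation (orb y σ) * hopFactor p j l σ := by
  have hne : ∀ z w : Λ, orb z (flipSpin σ) ≠ orb w σ := fun z w h =>
    flipSpin_ne σ (orb_eq_orb_iff.1 h).2
  have hj := numberAt_commute_hop (hne j x) (hne j y)
  have hl := numberAt_commute_hop (hne l x) (hne l y)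
  simp only [hopFactor, add_mul, mul_add, smul_mul_assoc, mul_smul_comm, one_mul, mul_one]
  rw [show numberOp j (flipSpin σ) = numberAt (orb j (flipSpin σ)) from rfl,
    show numberOp l (flipSpin σ) = numberAt (orb l (flipSpin σ)) from rfl, hj, hl]

/-- The correlated-hopping factor is Hermitian (real diagonal). [cite: deBoerSchadschneider1995, eq. (1)] -/
theorem hopFactor_conjTranspose (p : Params) (j l : Λ) (σ : Fin 2) :
    (hopFactor p j l σ)ᴴ = hopFactor p j l σ := by
  rw [hopFactor_eq_diagonal, diagonal_conjTranspose]
  congr 1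
  funext α
  simp

/-- The diagonal part is Hermitian. [cite: deBoerSchadschneider1995, eq. (1)] -/
theorem diagOp_conjTranspose (p : Params) (j l : Λ) : (diagOp p j l)ᴴ = diagOp p j l := by
  rw [diagOp_eq_diagonal, diagonal_conjTranspose]
  congr 1
  funext α
  simp

/-- `(c†_{j↑} c†_{j↓} c_{l↓} c_{l↑})† = c†_{l↑} c†_{l↓} c_{j↓} c_{j↑}`. [cite: deBoerSchadschneider1995, eq. (1)] -/
theorem conjTranspose_pairCre_mul_pairAnn (j l : Λ) :
    (pairCre j * pairAnn l)ᴴ = pairCre l * pairAnn j := by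
  simp only [pairCre, pairAnn, conjTranspose_mul, annihilation_conjTranspose, creation_conjTranspose,
    mul_assoc]

/-- `(S⁺_j S⁻_l)† = S⁺_l S⁻_j`. [cite: deBoerSchadschneider1995, eq. (1)] -/
theorem conjTranspose_spinFlip (j l : Λ) :
    (fermionSpinPlus j * fermionSpinMinus l)ᴴ = fermionSpinPlus l * fermionSpinMinus j := by
  rw [conjTranspose_mul, conjTranspose_fermionSpinPlus, conjTranspose_fermionSpinMinus]

/-- `(c†_a c_b F)† = F c†_b c_a` for a Hermitian factor `F`. [folklore] -/
private theorem conjTranspose_hop_mul {a b : Orb Λ} {F : Matrix (Finset (Orb Λ)) (Finset (Orb Λ)) ℂ}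
    (hF : Fᴴ = F) : (creation a * annihilation b * F)ᴴ = F * (creation b * annihilation a) := by
  rw [conjTranspose_mul, conjTranspose_creation_mul_annihilation, hF]

/-- **The bond Hamiltonian is Hermitian.** [cite: deBoerSchadschneider1995, eq. (1)] -/
theorem bondHamiltonian_isHermitian (p : Params) (j l : Λ) : (bondHamiltonian p j l).IsHermitian := by
  have hreal : ∀ r : ℝ, star ((r : ℝ) : ℂ) = (r : ℂ) := fun r => Complex.conj_ofReal r
  have hhop : ∀ σ : Fin 2,
      (creation (orb j σ) * annihilation (orb l σ) * hopFactor p j l σ +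
          creation (orb l σ) * annihilation (orb j σ) * hopFactor p j l σ)ᴴ =
        creation (orb j σ) * annihilation (orb l σ) * hopFactor p j l σ +
          creation (orb l σ) * annihilation (orb j σ) * hopFactor p j l σ := by
    intro σ
    rw [conjTranspose_add, conjTranspose_hop_mul (hopFactor_conjTranspose p j l σ),
      conjTranspose_hop_mul (hopFactor_conjTranspose p j l σ),
      hopFactor_commute_hop, hopFactor_commute_hop, add_comm]
  unfold Matrix.IsHermitian
  rw [bondHamiltonian_eq]
  simp only [conjTranspose_add, conjTranspose_sum, conjTranspose_smul, hhop, diagOp_conjTranspose,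
    conjTranspose_pairCre_mul_pairAnn, conjTranspose_spinFlip, hreal]
  abel

variable (G : SimpleGraph Λ) [DecidableRel G.Adj]

omit [LinearOrder Λ] [Fintype Λ] in
/-- A finite sum of Hermitian matrices is Hermitian. [folklore] -/
private theorem isHermitian_sum_of_forall' {κ m : Type*} (s : Finset κ)
    {f : κ → Matrix m m ℂ} (h : ∀ k ∈ s, (f k).IsHermitian) :
    (∑ k ∈ s, f k).IsHermitian := by
  unfold Matrix.IsHermitian
  rw [conjTranspose_sum]
  exact Finset.sum_congr rfl fun k hk => (h k hk).eq

/-- **The generalized Hubbard Hamiltonian is Hermitian.** [cite: deBoerSchadschneider1995, eq. (1)] -/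
theorem hamiltonian_isHermitian (p : Params) : (hamiltonian G p).IsHermitian := by
  unfold hamiltonian
  refine isHermitian_sum_of_forall' _ fun j _ => isHermitian_sum_of_forall' _ fun l _ => ?_
  split_ifs
  · exact bondHamiltonian_isHermitian p j l
  · exact isHermitian_zero

end Structure

/-! ### Elementary moves on occupation-basis vectors and their Gerschgorin data -/

section Moves

variable {Λ : Type*} [LinearOrder Λ] [Fintype Λ]

omit [Fintype Λ] in
/-- `0 ≤ occ ≤ 1`. [cite: deBoerSchadschneider1995, eq. (2)] -/
theorem occ_nonneg (α : Finset (Orb Λ)) (i : Orb Λ) : 0 ≤ occ α i := by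
  unfold occ; split_ifs <;> norm_num

omit [Fintype Λ] in
/-- `0 ≤ occ ≤ 1`. [cite: deBoerSchadschneider1995, eq. (2)] -/
theorem occ_le_one (α : Finset (Orb Λ)) (i : Orb Λ) : occ α i ≤ 1 := by
  unfold occ; split_ifs <;> norm_num

/-- A matrix entry is a component of the image of a basis vector: `T β α = (T |α⟩)_β`. [cite: Tasaki2020, §9.2] -/
theorem apply_eq_mulVec_single (T : Matrix (Finset (Orb Λ)) (Finset (Orb Λ)) ℂ) (β α : Finset (Orb Λ)) :
    T β α = (T *ᵥ Pi.single α 1) β := by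
  rw [Matrix.mulVec_single_one]; rfl

omit [Fintype Λ] in
/-- `Pi.single α c = c • Pi.single α 1`. [folklore] -/
private theorem single_eq_smul_single (α : Finset (Orb Λ)) (c : ℂ) :
    (Pi.single α c : Fock (Orb Λ)) = c • Pi.single α 1 := by
  ext β
  simp only [Pi.smul_apply, Pi.single_apply, smul_eq_mul]
  split_ifs <;> simp

/-- A diagonal matrix acts on basis vectors by scalars. [cite: Tasaki2020, §9.2] -/
theorem diagonal_mulVec_single_one (d : Finset (Orb Λ) → ℂ) (α : Finset (Orb Λ)) :
    diagonal d *ᵥ (Pi.single α 1 : Fock (Orb Λ)) = d α • Pi.single α 1 := by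
  rw [diagonal_mulVec_single, mul_one, single_eq_smul_single]

/-- **Hopping on a basis vector**: `c†_a c_b |α⟩ = ± |α ∖ b ∪ a⟩` if `b ∈ α`, `a ∉ α`, else `0`
(`a ≠ b`). [cite: Tasaki2020, §9.2] -/
theorem hop_mulVec_single {a b : Orb Λ} (hab : a ≠ b) (α : Finset (Orb Λ)) :
    (creation a * annihilation b) *ᵥ (Pi.single α (1 : ℂ)) =
      if b ∈ α ∧ a ∉ α then
        (jwSign b α * jwSign a (α.erase b)) • Pi.single (insert a (α.erase b)) 1
      else 0 := by
  rw [← mulVec_mulVec, annihilation_mulVec_single]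
  by_cases hb : b ∈ α
  · rw [if_pos hb, mulVec_smul, FermionOperators.creation_mulVec_single]
    by_cases ha : a ∈ α
    · have ha' : a ∈ α.erase b := Finset.mem_erase.2 ⟨hab, ha⟩
      rw [if_pos ha', smul_zero, if_neg (fun h => h.2 ha)]
    · have ha' : a ∉ α.erase b := fun h => ha (Finset.mem_of_mem_erase h)
      rw [if_neg ha', if_pos ⟨hb, ha⟩, smul_smul]
  · rw [if_neg hb, mulVec_zero, if_neg (fun h => hb h.1)]

/-- **A move.** `T` acts on the basis vector `|α⟩` as `T |α⟩ = c |β⟩` with `‖c‖ ≤ b`, and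
`β ≠ α` unless `c = 0`: the datum from which the Gerschgorin column sum of `T` at `α` is read off.
[cite: deBoerKorepinSchadschneider1995, eq. (7)] -/
def IsMove (T : Matrix (Finset (Orb Λ)) (Finset (Orb Λ)) ℂ) (α : Finset (Orb Λ)) (b : ℝ) : Prop :=
  ∃ (c : ℂ) (β : Finset (Orb Λ)), T *ᵥ Pi.single α 1 = c • Pi.single β 1 ∧ ‖c‖ ≤ b ∧ (c ≠ 0 → β ≠ α)

namespace IsMove

variable {T : Matrix (Finset (Orb Λ)) (Finset (Orb Λ)) ℂ} {α : Finset (Orb Λ)} {b : ℝ}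

/-- A term annihilating `|α⟩` is a move of any nonnegative weight. [cite: deBoerKorepinSchadschneider1995, eq. (7)] -/
theorem of_mulVec_eq_zero (h : T *ᵥ Pi.single α 1 = 0) (hb : 0 ≤ b) : IsMove T α b :=
  ⟨0, α, by rw [h, zero_smul], by simpa using hb, fun h => (h rfl).elim⟩

/-- Constructor from an explicit image `c |β⟩`, `β ≠ α`. [cite: deBoerKorepinSchadschneider1995, eq. (7)] -/
theorem of_mulVec_eq {c : ℂ} {β : Finset (Orb Λ)} (h : T *ᵥ Pi.single α 1 = c • Pi.single β 1)
    (hc : ‖c‖ ≤ b) (hβ : β ≠ α) : IsMove T α b :=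
  ⟨c, β, h, hc, fun _ => hβ⟩

/-- The weight of a move is nonnegative. [cite: deBoerKorepinSchadschneider1995, eq. (7)] -/
theorem nonneg (h : IsMove T α b) : 0 ≤ b := by
  obtain ⟨c, β, -, hc, -⟩ := h
  exact (norm_nonneg c).trans hc

/-- Scaling a move scales its weight. [cite: deBoerKorepinSchadschneider1995, eq. (7)] -/
theorem smul (k : ℂ) (h : IsMove T α b) : IsMove (k • T) α (‖k‖ * b) := by
  obtain ⟨c, β, hT, hc, hβ⟩ := h
  refine ⟨k * c, β, by rw [smul_mulVec, hT, smul_smul], ?_, fun hkc => hβ (right_ne_zero_of_mul hkc)⟩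
  rw [norm_mul]
  exact mul_le_mul_of_nonneg_left hc (norm_nonneg k)

/-- Weakening of the weight. [cite: deBoerKorepinSchadschneider1995, eq. (7)] -/
theorem mono {b' : ℝ} (h : IsMove T α b) (hb : b ≤ b') : IsMove T α b' := by
  obtain ⟨c, β, hT, hc, hβ⟩ := h
  exact ⟨c, β, hT, hc.trans hb, hβ⟩

/-- A move has vanishing diagonal entry. [cite: deBoerKorepinSchadschneider1995, eq. (7)] -/
theorem apply_self (h : IsMove T α b) : T α α = 0 := by
  obtain ⟨c, β, hT, -, hβ⟩ := h
  rw [apply_eq_mulVec_single T α α, hT, Pi.smul_apply, smul_eq_mul]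
  by_cases hc : c = 0
  · rw [hc, zero_mul]
  · rw [Pi.single_eq_of_ne (hβ hc).symm, mul_zero]

/-- The off-diagonal column sum of a move is at most its weight.
[cite: deBoerKorepinSchadschneider1995, eq. (7)] -/
theorem sum_norm_le (h : IsMove T α b) : ∑ β ∈ univ.erase α, ‖T β α‖ ≤ b := by
  obtain ⟨c, β, hT, hc, -⟩ := h
  have hent : ∀ β', T β' α = c * (Pi.single β (1 : ℂ) : Fock (Orb Λ)) β' := fun β' => by
    rw [apply_eq_mulVec_single T β' α, hT, Pi.smul_apply, smul_eq_mul]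
  have hnorm : ∀ β', ‖(Pi.single β (1 : ℂ) : Fock (Orb Λ)) β'‖ = if β' = β then 1 else 0 := by
    intro β'
    by_cases h : β' = β
    · subst h; simp
    · rw [Pi.single_eq_of_ne h, norm_zero, if_neg h]
  simp_rw [hent, norm_mul, hnorm, mul_ite, mul_one, mul_zero]
  rw [Finset.sum_ite_eq']
  split_ifs
  · exact hc
  · exact (norm_nonneg c).trans hc

end IsMove

/-- The off-diagonal column sum `Σ_{β ≠ α} ‖T_βα‖`. [cite: deBoerKorepinSchadschneider1995, eq. (7)] -/
def colOff (T : Matrix (Finset (Orb Λ)) (Finset (Orb Λ)) ℂ) (α : Finset (Orb Λ)) : ℝ :=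
  ∑ β ∈ univ.erase α, ‖T β α‖

/-- Subadditivity of the off-diagonal column sum. [cite: deBoerKorepinSchadschneider1995, eq. (7)] -/
theorem colOff_add_le (A B : Matrix (Finset (Orb Λ)) (Finset (Orb Λ)) ℂ) (α : Finset (Orb Λ)) :
    colOff (A + B) α ≤ colOff A α + colOff B α := by
  unfold colOff
  rw [← Finset.sum_add_distrib]
  exact Finset.sum_le_sum fun β _ => by rw [Matrix.add_apply]; exact norm_add_le _ _

/-- Subadditivity of the off-diagonal column sum over finite sums. [cite: deBoerKorepinSchadschneider1995, eq. (7)] -/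
theorem colOff_sum_le {κ : Type*} (s : Finset κ) (f : κ → Matrix (Finset (Orb Λ)) (Finset (Orb Λ)) ℂ)
    (α : Finset (Orb Λ)) : colOff (∑ k ∈ s, f k) α ≤ ∑ k ∈ s, colOff (f k) α := by
  classical
  induction s using Finset.induction_on with
  | empty => simp [colOff]
  | insert k s hk ih =>
    rw [Finset.sum_insert hk, Finset.sum_insert hk]
    exact (colOff_add_le _ _ α).trans (by linarith)

/-- A diagonal matrix has no off-diagonal column sum. [cite: deBoerKorepinSchadschneider1995, eq. (7)] -/
theorem colOff_diagonal (d : Finset (Orb Λ) → ℂ) (α : Finset (Orb Λ)) : colOff (diagonal d) α = 0 := by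
  unfold colOff
  exact Finset.sum_eq_zero fun β hβ => by
    rw [diagonal_apply_ne _ (Finset.ne_of_mem_erase hβ), norm_zero]

/-- The off-diagonal column sum of a move is at most its weight. [cite: deBoerKorepinSchadschneider1995, eq. (7)] -/
theorem IsMove.colOff_le {T : Matrix (Finset (Orb Λ)) (Finset (Orb Λ)) ℂ} {α : Finset (Orb Λ)} {b : ℝ}
    (h : IsMove T α b) : colOff T α ≤ b :=
  h.sum_norm_le

/-! ### The eight moves of the bond Hamiltonian -/

/-- `hopFactor` is symmetric in the bond. [cite: deBoerSchadschneider1995, eq. (1)] -/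
theorem hopFactor_comm (p : Params) (j l : Λ) (σ : Fin 2) : hopFactor p j l σ = hopFactor p l j σ := by
  unfold hopFactor; rw [add_comm (numberOp j _)]

/-- The weight of the correlated hop `c†_{jσ} c_{lσ} (-t + X(n_{j,-σ} + n_{l,-σ}))` at `α`:
`|-t + X([j,-σ] + [l,-σ])| · [lσ ∈ α] · [jσ ∉ α]`. [cite: deBoerSchadschneider1995, eq. (2)] -/
def hopWeight (p : Params) (j l : Λ) (σ : Fin 2) (α : Finset (Orb Λ)) : ℝ :=
  |-p.t + p.X * (occ α (orb j (flipSpin σ)) + occ α (orb l (flipSpin σ)))| *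
    (occ α (orb l σ) * (1 - occ α (orb j σ)))

/-- **The correlated hop is a move** of weight `hopWeight`. [cite: deBoerSchadschneider1995, eq. (2)] -/
theorem isMove_hop (p : Params) {j l : Λ} (hjl : j ≠ l) (σ : Fin 2) (α : Finset (Orb Λ)) :
    IsMove (creation (orb j σ) * annihilation (orb l σ) * hopFactor p j l σ) α (hopWeight p j l σ α) := by
  have hne : orb j σ ≠ orb l σ := EtaPairingODLRO.orb_ne_orb_of_ne hjl σ σ
  set f : ℝ := -p.t + p.X * (occ α (orb j (flipSpin σ)) + occ α (orb l (flipSpin σ))) with hf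
  have hact : (creation (orb j σ) * annihilation (orb l σ) * hopFactor p j l σ) *ᵥ (Pi.single α (1 : ℂ)) =
      (f : ℂ) • ((creation (orb j σ) * annihilation (orb l σ)) *ᵥ Pi.single α 1) := by
    rw [← mulVec_mulVec, hopFactor_eq_diagonal, diagonal_mulVec_single_one, mulVec_smul]
  by_cases hcond : orb l σ ∈ α ∧ orb j σ ∉ α
  · refine IsMove.of_mulVec_eq (c := (f : ℂ) * (jwSign (orb l σ) α * jwSign (orb j σ) (α.erase (orb l σ))))
      (β := insert (orb j σ) (α.erase (orb l σ))) ?_ ?_ ?_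
    · rw [hact, hop_mulVec_single hne, if_pos hcond, smul_smul]
    · rw [norm_mul, norm_mul, norm_jwSign, norm_jwSign, mul_one, mul_one, Complex.norm_real,
        Real.norm_eq_abs, hopWeight, occ_of_mem hcond.1, occ_of_not_mem hcond.2]
      simp [hf]
    · intro h
      exact hcond.2 (h ▸ Finset.mem_insert_self _ _)
  · refine IsMove.of_mulVec_eq_zero ?_ ?_
    · rw [hact, hop_mulVec_single hne, if_neg hcond, smul_zero]
    · exact mul_nonneg (abs_nonneg _)
        (mul_nonneg (occ_nonneg _ _) (sub_nonneg.2 (occ_le_one _ _)))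

/-- The weight of the pair hop `c†_{j↑} c†_{j↓} c_{l↓} c_{l↑}` at `α`:
`[l↑, l↓ ∈ α] · [j↑, j↓ ∉ α]`. [cite: deBoerSchadschneider1995, eq. (2)] -/
def pairWeight (j l : Λ) (α : Finset (Orb Λ)) : ℝ :=
  occ α (orb l 0) * occ α (orb l 1) * (1 - occ α (orb j 0)) * (1 - occ α (orb j 1))

omit [Fintype Λ] in
/-- `0 ≤ pairWeight`. [cite: deBoerSchadschneider1995, eq. (2)] -/
theorem pairWeight_nonneg (j l : Λ) (α : Finset (Orb Λ)) : 0 ≤ pairWeight j l α :=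
  mul_nonneg (mul_nonneg (mul_nonneg (occ_nonneg _ _) (occ_nonneg _ _))
    (sub_nonneg.2 (occ_le_one _ _))) (sub_nonneg.2 (occ_le_one _ _))

/-- **The pair hop is a move** of weight `pairWeight`. [cite: deBoerSchadschneider1995, eq. (2)] -/
theorem isMove_pair {j l : Λ} (hjl : j ≠ l) (α : Finset (Orb Λ)) :
    IsMove (pairCre j * pairAnn l) α (pairWeight j l α) := by
  have hjl' := EtaPairingODLRO.orb_ne_orb_of_ne hjl
  have h01 := EtaPairingODLRO.orb_zero_ne_orb_one (Λ := Λ)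
  have hact : (pairCre j * pairAnn l) *ᵥ (Pi.single α (1 : ℂ)) =
      creation (orb j 0) *ᵥ (creation (orb j 1) *ᵥ
        (annihilation (orb l 1) *ᵥ (annihilation (orb l 0) *ᵥ Pi.single α 1))) := by
    simp only [pairCre, pairAnn, mul_assoc, mulVec_mulVec]
  by_cases hl0 : orb l 0 ∈ α
  · have hl1e : orb l 1 ∈ α.erase (orb l 0) ↔ orb l 1 ∈ α := by
      rw [Finset.mem_erase]; exact ⟨fun h => h.2, fun h => ⟨(h01 l).symm, h⟩⟩
    by_cases hl1 : orb l 1 ∈ α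
    · set u : Finset (Orb Λ) := (α.erase (orb l 0)).erase (orb l 1) with hu
      have hj1u : orb j 1 ∈ u ↔ orb j 1 ∈ α := by
        simp [hu, Finset.mem_erase, hjl' 1 1, hjl' 1 0]
      have hj0u : orb j 0 ∈ insert (orb j 1) u ↔ orb j 0 ∈ α := by
        simp [hu, Finset.mem_insert, Finset.mem_erase, hjl' 0 1, hjl' 0 0, h01 j]
      by_cases hj1 : orb j 1 ∈ α
      · refine IsMove.of_mulVec_eq_zero ?_ (pairWeight_nonneg j l α)
        rw [hact, annihilation_mulVec_single, if_pos hl0, mulVec_smul, annihilation_mulVec_single,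
          if_pos (hl1e.2 hl1), smul_smul, ← hu, mulVec_smul, FermionOperators.creation_mulVec_single,
          if_pos (hj1u.2 hj1), smul_zero, mulVec_zero]
      · by_cases hj0 : orb j 0 ∈ α
        · refine IsMove.of_mulVec_eq_zero ?_ (pairWeight_nonneg j l α)
          rw [hact, annihilation_mulVec_single, if_pos hl0, mulVec_smul, annihilation_mulVec_single,
            if_pos (hl1e.2 hl1), smul_smul, ← hu, mulVec_smul, FermionOperators.creation_mulVec_single,
            if_neg (fun h => hj1 (hj1u.1 h)), smul_smul, mulVec_smul,
            FermionOperators.creation_mulVec_single, if_pos (hj0u.2 hj0), smul_zero]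
        · -- the move happens
          refine IsMove.of_mulVec_eq
            (c := jwSign (orb l 0) α * jwSign (orb l 1) (α.erase (orb l 0)) * jwSign (orb j 1) u *
              jwSign (orb j 0) (insert (orb j 1) u))
            (β := insert (orb j 0) (insert (orb j 1) u)) ?_ ?_ ?_
          · rw [hact, annihilation_mulVec_single, if_pos hl0, mulVec_smul, annihilation_mulVec_single,
              if_pos (hl1e.2 hl1), smul_smul, ← hu, mulVec_smul, FermionOperators.creation_mulVec_single,
              if_neg (fun h => hj1 (hj1u.1 h)), smul_smul, mulVec_smul,
              FermionOperators.creation_mulVec_single, if_neg (fun h => hj0 (hj0u.1 h)), smul_smul]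
          · rw [norm_mul, norm_mul, norm_mul, norm_jwSign, norm_jwSign, norm_jwSign, norm_jwSign,
              pairWeight, occ_of_mem hl0, occ_of_mem hl1, occ_of_not_mem hj0, occ_of_not_mem hj1]
            norm_num
          · intro h
            exact hj0 (h ▸ Finset.mem_insert_self _ _)
    · refine IsMove.of_mulVec_eq_zero ?_ (pairWeight_nonneg j l α)
      rw [hact, annihilation_mulVec_single, if_pos hl0, mulVec_smul, annihilation_mulVec_single,
        if_neg (fun h => hl1 (hl1e.1 h)), smul_zero, mulVec_zero, mulVec_zero]
  · refine IsMove.of_mulVec_eq_zero ?_ (pairWeight_nonneg j l α)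
    rw [hact, annihilation_mulVec_single, if_neg hl0, mulVec_zero, mulVec_zero, mulVec_zero]

/-- The weight of the spin flip `S⁺_j S⁻_l = c†_{j↑} c_{j↓} c†_{l↓} c_{l↑}` at `α`:
`[l↑ ∈ α] [l↓ ∉ α] [j↓ ∈ α] [j↑ ∉ α]`. [cite: deBoerSchadschneider1995, eq. (2)] -/
def flipWeight (j l : Λ) (α : Finset (Orb Λ)) : ℝ :=
  occ α (orb l 0) * (1 - occ α (orb l 1)) * occ α (orb j 1) * (1 - occ α (orb j 0))

omit [Fintype Λ] in
/-- `0 ≤ flipWeight`. [cite: deBoerSchadschneider1995, eq. (2)] -/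
theorem flipWeight_nonneg (j l : Λ) (α : Finset (Orb Λ)) : 0 ≤ flipWeight j l α :=
  mul_nonneg (mul_nonneg (mul_nonneg (occ_nonneg _ _) (sub_nonneg.2 (occ_le_one _ _)))
    (occ_nonneg _ _)) (sub_nonneg.2 (occ_le_one _ _))

/-- **The spin flip is a move** of weight `flipWeight`. [cite: deBoerSchadschneider1995, eq. (2)] -/
theorem isMove_flip {j l : Λ} (hjl : j ≠ l) (α : Finset (Orb Λ)) :
    IsMove (fermionSpinPlus j * fermionSpinMinus l) α (flipWeight j l α) := by
  have hjl' := EtaPairingODLRO.orb_ne_orb_of_ne hjl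
  have h01 := EtaPairingODLRO.orb_zero_ne_orb_one (Λ := Λ)
  have hact : (fermionSpinPlus j * fermionSpinMinus l) *ᵥ (Pi.single α (1 : ℂ)) =
      (creation (orb j 0) * annihilation (orb j 1)) *ᵥ
        ((creation (orb l 1) * annihilation (orb l 0)) *ᵥ Pi.single α 1) := by
    rw [fermionSpinPlus, fermionSpinMinus, mulVec_mulVec]
  by_cases hin : orb l 0 ∈ α ∧ orb l 1 ∉ α
  · set u : Finset (Orb Λ) := insert (orb l 1) (α.erase (orb l 0)) with hu
    have hj1u : orb j 1 ∈ u ↔ orb j 1 ∈ α := by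
      simp [hu, Finset.mem_insert, Finset.mem_erase, hjl' 1 1, hjl' 1 0]
    have hj0u : orb j 0 ∈ u ↔ orb j 0 ∈ α := by
      simp [hu, Finset.mem_insert, Finset.mem_erase, hjl' 0 1, hjl' 0 0]
    by_cases hout : orb j 1 ∈ α ∧ orb j 0 ∉ α
    · have hout' : orb j 1 ∈ u ∧ orb j 0 ∉ u := ⟨hj1u.2 hout.1, fun h => hout.2 (hj0u.1 h)⟩
      refine IsMove.of_mulVec_eq
        (c := jwSign (orb l 0) α * jwSign (orb l 1) (α.erase (orb l 0)) *
          (jwSign (orb j 1) u * jwSign (orb j 0) (u.erase (orb j 1))))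
        (β := insert (orb j 0) (u.erase (orb j 1))) ?_ ?_ ?_
      · rw [hact, hop_mulVec_single (h01 l).symm, if_pos hin, mulVec_smul, ← hu,
          hop_mulVec_single (h01 j), if_pos hout', smul_smul]
      · rw [norm_mul, norm_mul, norm_mul, norm_jwSign, norm_jwSign, norm_jwSign, norm_jwSign,
          flipWeight, occ_of_mem hin.1, occ_of_not_mem hin.2, occ_of_mem hout.1, occ_of_not_mem hout.2]
        norm_num
      · intro h
        exact hout.2 (h ▸ Finset.mem_insert_self _ _)
    · refine IsMove.of_mulVec_eq_zero ?_ (flipWeight_nonneg j l α)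
      have hout' : ¬(orb j 1 ∈ u ∧ orb j 0 ∉ u) := fun h => hout ⟨hj1u.1 h.1, fun h' => h.2 (hj0u.2 h')⟩
      rw [hact, hop_mulVec_single (h01 l).symm, if_pos hin, mulVec_smul, ← hu,
        hop_mulVec_single (h01 j), if_neg hout', smul_zero]
  · refine IsMove.of_mulVec_eq_zero ?_ (flipWeight_nonneg j l α)
    rw [hact, hop_mulVec_single (h01 l).symm, if_neg hin, mulVec_zero]

/-- **The total off-diagonal weight** of `h_{jl}` at `α` (sum of the eight move weights).
[cite: deBoerSchadschneider1995, eq. (2)] -/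
def offBound (p : Params) (j l : Λ) (α : Finset (Orb Λ)) : ℝ :=
  (∑ σ : Fin 2, (hopWeight p j l σ α + hopWeight p l j σ α)) +
    (|p.Y| * pairWeight j l α + |p.Y| * pairWeight l j α) +
    (|p.Jxy| / 2 * flipWeight j l α + |p.Jxy| / 2 * flipWeight l j α)

/-- `‖(J_xy/2 : ℂ)‖ = |J_xy|/2`. [folklore] -/
private theorem norm_half (r : ℝ) : ‖((r / 2 : ℝ) : ℂ)‖ = |r| / 2 := by
  rw [Complex.norm_real, Real.norm_eq_abs, abs_div, abs_two]

/-- **Diagonal entries of the bond Hamiltonian**: `(h_{jl})_{αα} = diagVal p j l α`.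
[cite: deBoerSchadschneider1995, eq. (2)] -/
theorem bondHamiltonian_apply_self (p : Params) {j l : Λ} (hjl : j ≠ l) (α : Finset (Orb Λ)) :
    bondHamiltonian p j l α α = ((diagVal p j l α : ℝ) : ℂ) := by
  have h1 : ∀ σ : Fin 2, (creation (orb j σ) * annihilation (orb l σ) * hopFactor p j l σ) α α = 0 :=
    fun σ => (isMove_hop p hjl σ α).apply_self
  have h2 : ∀ σ : Fin 2, (creation (orb l σ) * annihilation (orb j σ) * hopFactor p j l σ) α α = 0 :=
    fun σ => by rw [hopFactor_comm]; exact (isMove_hop p hjl.symm σ α).apply_self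
  have h3 := ((isMove_pair hjl α).smul (p.Y : ℂ)).apply_self
  have h4 := ((isMove_pair hjl.symm α).smul (p.Y : ℂ)).apply_self
  have h5 := ((isMove_flip hjl α).smul ((p.Jxy / 2 : ℝ) : ℂ)).apply_self
  have h6 := ((isMove_flip hjl.symm α).smul ((p.Jxy / 2 : ℝ) : ℂ)).apply_self
  rw [bondHamiltonian_eq]
  simp only [Matrix.add_apply, Matrix.sum_apply, h1, h2, h3, h4, h5, h6, add_zero, Finset.sum_const_zero,
    zero_add, diagOp_eq_diagonal, diagonal_apply_eq]

/-- **Off-diagonal column sums of the bond Hamiltonian**: `Σ_{β ≠ α} ‖(h_{jl})_{βα}‖ ≤ offBound`.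
[cite: deBoerSchadschneider1995, eq. (2)] -/
theorem bondHamiltonian_colOff_le (p : Params) {j l : Λ} (hjl : j ≠ l) (α : Finset (Orb Λ)) :
    colOff (bondHamiltonian p j l) α ≤ offBound p j l α := by
  have h1 : ∀ σ : Fin 2, colOff (creation (orb j σ) * annihilation (orb l σ) * hopFactor p j l σ) α ≤
      hopWeight p j l σ α := fun σ => (isMove_hop p hjl σ α).colOff_le
  have h2 : ∀ σ : Fin 2, colOff (creation (orb l σ) * annihilation (orb j σ) * hopFactor p j l σ) α ≤
      hopWeight p l j σ α := fun σ => by rw [hopFactor_comm]; exact (isMove_hop p hjl.symm σ α).colOff_le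
  have h3 : colOff ((p.Y : ℂ) • (pairCre j * pairAnn l)) α ≤ |p.Y| * pairWeight j l α := by
    have := ((isMove_pair hjl α).smul (p.Y : ℂ)).colOff_le; rwa [Complex.norm_real, Real.norm_eq_abs] at this
  have h4 : colOff ((p.Y : ℂ) • (pairCre l * pairAnn j)) α ≤ |p.Y| * pairWeight l j α := by
    have := ((isMove_pair hjl.symm α).smul (p.Y : ℂ)).colOff_le; rwa [Complex.norm_real, Real.norm_eq_abs] at this
  have h5 : colOff (((p.Jxy / 2 : ℝ) : ℂ) • (fermionSpinPlus j * fermionSpinMinus l)) α ≤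
      |p.Jxy| / 2 * flipWeight j l α := by
    have := ((isMove_flip hjl α).smul ((p.Jxy / 2 : ℝ) : ℂ)).colOff_le; rwa [norm_half] at this
  have h6 : colOff (((p.Jxy / 2 : ℝ) : ℂ) • (fermionSpinPlus l * fermionSpinMinus j)) α ≤
      |p.Jxy| / 2 * flipWeight l j α := by
    have := ((isMove_flip hjl.symm α).smul ((p.Jxy / 2 : ℝ) : ℂ)).colOff_le; rwa [norm_half] at this
  have hD : colOff (diagOp p j l) α = 0 := by rw [diagOp_eq_diagonal, colOff_diagonal]
  rw [bondHamiltonian_eq, offBound]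
  refine (colOff_add_le _ _ α).trans (add_le_add ((colOff_add_le _ _ α).trans (add_le_add
    ((colOff_add_le _ _ α).trans ?_) ((colOff_add_le _ _ α).trans (add_le_add h3 h4))))
    ((colOff_add_le _ _ α).trans (add_le_add h5 h6)))
  rw [hD, add_zero]
  refine (colOff_sum_le _ _ α).trans (Finset.sum_le_sum fun σ _ => ?_)
  exact (colOff_add_le _ _ α).trans (add_le_add (h1 σ) (h2 σ))

end Moves

/-! ## §4 The sixteen-configuration certificate (de Boer–Schadschneider eq. (9)) -/

section Certificate

variable {Λ : Type*} [LinearOrder Λ] [Fintype Λ]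

/-- The sixteen bond configurations: with `X = t`, `|Y| ≤ -2V`, `μ = 0` and the inequalities
(9) of de Boer–Schadschneider, the Gerschgorin datum `diagonal - off-diagonal weight` of every local
configuration `(a, b, c, d) = ([j↑], [j↓], [l↑], [l↓]) ∈ {0,1}⁴` is at least `E₀ = U/(2Z) + V`.
[cite: deBoerSchadschneider1995, eq. (2) and (9)] -/
theorem sixteen_configurations (t u V Y Jxy Jz : ℝ) (hop : 2 * |t| + 2 * V ≤ -u)
    (ferro : V - Jz / 4 ≤ -u) (flip : V + |Jxy| / 2 + Jz / 4 ≤ -u) (hY : |Y| ≤ -(2 * V))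
    (a b c d : ℝ) (ha : a = 0 ∨ a = 1) (hb : b = 0 ∨ b = 1) (hc : c = 0 ∨ c = 1)
    (hd : d = 0 ∨ d = 1) :
    u / 2 + V ≤
      (u * ((a - 1 / 2) * (b - 1 / 2) + (c - 1 / 2) * (d - 1 / 2)) + V * ((a + b - 1) * (c + d - 1)) +
          Jz / 4 * ((a - b) * (c - d))) -
        ((|-t + t * (b + d)| * (c * (1 - a)) + |-t + t * (d + b)| * (a * (1 - c))) +
            (|-t + t * (a + c)| * (d * (1 - b)) + |-t + t * (c + a)| * (b * (1 - d))) +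
          (|Y| * (c * d * (1 - a) * (1 - b)) + |Y| * (a * b * (1 - c) * (1 - d))) +
          (|Jxy| / 2 * (c * (1 - d) * b * (1 - a)) + |Jxy| / 2 * (a * (1 - b) * d * (1 - c)))) := by
  have habs : ∀ m : ℝ, |-t + t * m| = |t| * |m - 1| := fun m => by
    rw [show -t + t * m = t * (m - 1) by ring, abs_mul]
  simp only [habs]
  have h0 := abs_nonneg t
  have h1 := abs_nonneg Jxy
  have h2 := abs_nonneg Y
  rcases ha with rfl | rfl <;> rcases hb with rfl | rfl <;> rcases hc with rfl | rfl <;>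
    rcases hd with rfl | rfl <;> norm_num <;> linarith

omit [Fintype Λ] in
/-- **The local Gerschgorin certificate** for the `η`-pairing regime: with `X = t`, `μ = 0`,
`|Y| ≤ -2V` and the inequalities (9) of de Boer–Schadschneider, every configuration `α` has
`diagVal - offBound ≥ E₀ = U/(2Z) + V`. [cite: deBoerSchadschneider1995, eq. (9)] -/
theorem localGershgorin_ge (p : Params) (hI : OGSInequalities p) (ht : p.X = p.t)
    (hY : |p.Y| ≤ -(2 * p.V)) (hμ : p.μ = 0) (j l : Λ) (α : Finset (Orb Λ)) :
    localEnergy p ≤ diagVal p j l α - offBound p j l α := by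
  have h := sixteen_configurations p.t (p.U / p.Z) p.V p.Y p.Jxy p.Jz hI.hop hI.ferro hI.flip hY
    (occ α (orb j 0)) (occ α (orb j 1)) (occ α (orb l 0)) (occ α (orb l 1))
    (occ_eq_zero_or_one _ _) (occ_eq_zero_or_one _ _) (occ_eq_zero_or_one _ _) (occ_eq_zero_or_one _ _)
  have hE : localEnergy p = p.U / p.Z / 2 + p.V := by unfold localEnergy; ring
  rw [hE]
  simp only [diagVal, diagFormula, offBound, hopWeight, pairWeight, flipWeight, Fin.sum_univ_two,
    flipSpin_zero, flipSpin_one, ht, hμ, zero_div, zero_mul, add_zero] at h ⊢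
  linarith

end Certificate

/-! ## §5 The `η`-pairing states are eigenvectors of every bond Hamiltonian -/

section EtaPairing

variable {Λ : Type*} [LinearOrder Λ] [Fintype Λ]

/-- A configuration is PAIRED if every site is empty or doubly occupied (the configurations out of
which `(η†)^N |0⟩` is built: locally `|00⟩, |22⟩, |20⟩, |02⟩`).
[cite: deBoerSchadschneider1995, before eq. (9)] -/
def IsPaired (s : Finset (Orb Λ)) : Prop := ∀ x : Λ, orb x 0 ∈ s ↔ orb x 1 ∈ s

/-- The fully paired configuration with the sites of `S` doubly occupied. [folklore] -/
def pairConfig (S : Finset Λ) : Finset (Orb Λ) :=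
  (S ×ˢ (univ : Finset (Fin 2))).map (Equiv.toEmbedding toLex)

omit [LinearOrder Λ] [Fintype Λ] in
/-- Membership in `pairConfig S` is membership of the site in `S`. [cite: deBoerSchadschneider1995, eq. (8) and before eq. (9)] -/
theorem mem_pairConfig (S : Finset Λ) (i : Orb Λ) : i ∈ pairConfig S ↔ (ofLex i).1 ∈ S := by
  simp [pairConfig, Finset.mem_map_equiv]

omit [LinearOrder Λ] [Fintype Λ] in
/-- `xσ ∈ pairConfig S ↔ x ∈ S`. [cite: deBoerSchadschneider1995, eq. (8) and before eq. (9)] -/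
theorem orb_mem_pairConfig (S : Finset Λ) (x : Λ) (σ : Fin 2) : orb x σ ∈ pairConfig S ↔ x ∈ S := by
  rw [mem_pairConfig]; rfl

omit [LinearOrder Λ] [Fintype Λ] in
/-- `pairConfig S` is paired. [cite: deBoerSchadschneider1995, eq. (8) and before eq. (9)] -/
theorem isPaired_pairConfig (S : Finset Λ) : IsPaired (pairConfig S) := fun x => by
  rw [orb_mem_pairConfig, orb_mem_pairConfig]

omit [LinearOrder Λ] [Fintype Λ] in
/-- `pairConfig` is injective. [cite: deBoerSchadschneider1995, eq. (8) and before eq. (9)] -/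
theorem pairConfig_injective : Function.Injective (pairConfig (Λ := Λ)) := fun S T h => by
  ext x; rw [← orb_mem_pairConfig S x 0, ← orb_mem_pairConfig T x 0, h]

/-- A paired configuration is `pairConfig` of its set of occupied sites. [cite: deBoerSchadschneider1995, eq. (8) and before eq. (9)] -/
theorem IsPaired.eq_pairConfig {s : Finset (Orb Λ)} (hs : IsPaired s) :
    s = pairConfig (univ.filter fun x => orb x 0 ∈ s) := by
  ext i
  rw [mem_pairConfig, Finset.mem_filter]
  obtain ⟨⟨x, σ⟩, rfl⟩ := toLex.surjective i
  simp only [ofLex_toLex, Finset.mem_univ, true_and]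
  fin_cases σ
  · rfl
  · exact (hs x).symm

omit [Fintype Λ] in
/-- Occupation numbers of a paired configuration. [cite: deBoerSchadschneider1995, eq. (8) and before eq. (9)] -/
theorem occ_pairConfig (S : Finset Λ) (x : Λ) (σ : Fin 2) :
    occ (pairConfig S) (orb x σ) = if x ∈ S then 1 else 0 := by
  unfold occ; simp only [orb_mem_pairConfig]

omit [Fintype Λ] in
/-- **The pair move**: removing the pair at `j` from `pairConfig S` and creating one at `l` gives
`pairConfig (S ∖ j ∪ l)`. [cite: deBoerSchadschneider1995, eq. (8) and before eq. (9)] -/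
theorem pairConfig_move {j l : Λ} (hjl : j ≠ l) (S : Finset Λ) :
    insert (orb l 0) (insert (orb l 1) (((pairConfig S).erase (orb j 0)).erase (orb j 1))) =
      pairConfig (insert l (S.erase j)) := by
  ext i
  obtain ⟨⟨x, σ⟩, rfl⟩ := toLex.surjective i
  simp only [Finset.mem_insert, Finset.mem_erase, mem_pairConfig, ofLex_toLex, orb, toLex_inj,
    Prod.mk.injEq, ne_eq]
  constructor
  · rintro (⟨rfl, -⟩ | ⟨rfl, -⟩ | ⟨h1, h0, hx⟩)
    · exact Or.inl rfl
    · exact Or.inl rfl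
    · refine Or.inr ⟨fun h => ?_, hx⟩
      subst h
      fin_cases σ
      · exact h0 ⟨rfl, rfl⟩
      · exact h1 ⟨rfl, rfl⟩
  · rintro (rfl | ⟨hx, hxS⟩)
    · fin_cases σ
      · exact Or.inl ⟨rfl, rfl⟩
      · exact Or.inr (Or.inl ⟨rfl, rfl⟩)
    · exact Or.inr (Or.inr ⟨fun h => hx h.1, fun h => hx h.1, hxS⟩)

/-- `(η†_ε)^N |0⟩ = N! Σ_{#S = N} ε_S |pairConfig S⟩` (the tree's `etaRaise_pow_mulVec_vacuum`).
[cite: deBoerSchadschneider1995, eq. (8)] -/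
theorem etaPairingState_eq_sum (ε : Λ → ℤˣ) (N : ℕ) :
    etaPairingState ε N = (N.factorial : ℂ) • ∑ S ∈ powersetCard N univ,
      (∏ x ∈ S, ((ε x : ℤ) : ℂ)) • (Pi.single (pairConfig S) 1 : Fock (Orb Λ)) := by
  rw [etaPairingState]
  exact etaRaise_pow_mulVec_vacuum (fun S i => mem_pairConfig S i) ε N

/-- The amplitude of `(η†_ε)^N |0⟩` on a fully paired configuration:
`N! ε_S` if `#S = N`, else `0`. [cite: deBoerSchadschneider1995, eq. (8)] -/
theorem etaPairingState_apply_pairConfig (ε : Λ → ℤˣ) (N : ℕ) (S : Finset Λ) :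
    etaPairingState ε N (pairConfig S) =
      if S.card = N then (N.factorial : ℂ) * ∏ x ∈ S, ((ε x : ℤ) : ℂ) else 0 := by
  rw [etaPairingState_eq_sum, Pi.smul_apply, Finset.sum_apply, smul_eq_mul]
  have hterm : ∀ T ∈ powersetCard N (univ : Finset Λ),
      ((∏ x ∈ T, ((ε x : ℤ) : ℂ)) • (Pi.single (pairConfig T) (1 : ℂ) : Fock (Orb Λ))) (pairConfig S) =
        if S = T then ∏ x ∈ T, ((ε x : ℤ) : ℂ) else 0 := by
    intro T _
    rw [Pi.smul_apply, smul_eq_mul]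
    by_cases h : S = T
    · rw [h, Pi.single_eq_same, mul_one, if_pos rfl]
    · rw [Pi.single_eq_of_ne (fun h' => h (pairConfig_injective h')), mul_zero, if_neg h]
  rw [Finset.sum_congr rfl hterm, Finset.sum_ite_eq]
  simp only [Finset.mem_powersetCard, Finset.subset_univ, true_and]
  split_ifs <;> simp

/-- `(η†_ε)^N |0⟩` is supported on paired configurations. [cite: deBoerSchadschneider1995, eq. (8)] -/
theorem etaPairingState_apply_of_not_isPaired (ε : Λ → ℤˣ) (N : ℕ) {s : Finset (Orb Λ)}
    (hs : ¬IsPaired s) : etaPairingState ε N s = 0 := by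
  rw [etaPairingState_eq_sum, Pi.smul_apply, Finset.sum_apply, smul_eq_mul]
  refine mul_eq_zero_of_right _ (Finset.sum_eq_zero fun T _ => ?_)
  rw [Pi.smul_apply, smul_eq_mul, Pi.single_eq_of_ne, mul_zero]
  intro h
  exact hs (h ▸ isPaired_pairConfig T)

omit [Fintype Λ] in
/-- `ε_{S ∖ j ∪ l} = ε_j ε_l ε_S` (`ε_j² = 1`). [cite: deBoerSchadschneider1995, eq. (10)] -/
theorem prod_sign_insert_erase (ε : Λ → ℤˣ) {S : Finset Λ} {j l : Λ} (hj : j ∈ S) (hl : l ∉ S) :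
    ∏ x ∈ insert l (S.erase j), ((ε x : ℤ) : ℂ) =
      ((ε j : ℤ) : ℂ) * ((ε l : ℤ) : ℂ) * ∏ x ∈ S, ((ε x : ℤ) : ℂ) := by
  have hl' : l ∉ S.erase j := fun h => hl (Finset.mem_of_mem_erase h)
  have hjj : ((ε j : ℤ) : ℂ) * ((ε j : ℤ) : ℂ) = 1 := by
    rw [← Int.cast_mul, ← Units.val_mul, Int.units_mul_self, Units.val_one, Int.cast_one]
  rw [Finset.prod_insert hl', ← Finset.mul_prod_erase S _ hj]
  rw [show ((ε j : ℤ) : ℂ) * ((ε l : ℤ) : ℂ) * (((ε j : ℤ) : ℂ) * ∏ x ∈ S.erase j, ((ε x : ℤ) : ℂ)) =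
    (((ε j : ℤ) : ℂ) * ((ε j : ℤ) : ℂ)) * (((ε l : ℤ) : ℂ) * ∏ x ∈ S.erase j, ((ε x : ℤ) : ℂ)) by ring,
    hjj, one_mul]

omit [LinearOrder Λ] [Fintype Λ] in
/-- In a paired configuration, `x,-σ` is occupied iff `xσ` is. [cite: deBoerSchadschneider1995, eq. (8) and before eq. (9)] -/
theorem IsPaired.mem_flip_iff {u : Finset (Orb Λ)} (hu : IsPaired u) (x : Λ) (σ : Fin 2) :
    orb x (flipSpin σ) ∈ u ↔ orb x σ ∈ u := by
  fin_cases σ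
  · exact (hu x).symm
  · exact hu x

/-! ### The terms of the bond Hamiltonian on vectors supported on paired configurations -/

/-- **The correlated hop kills paired vectors** (the `t = X` cancellation
`-t + X(n_{j,-σ} + n_{l,-σ}) = 0` between `|20⟩` and `|σ σ'⟩`).
[cite: deBoerKorepinSchadschneider1995, eq. (5)] -/
theorem hopTerm_mulVec_apply_of_paired (p : Params) {j l : Λ} (hjl : j ≠ l) (ht : p.X = p.t)
    (σ : Fin 2) {f : Fock (Orb Λ)} (hf : ∀ s, ¬IsPaired s → f s = 0) (s : Finset (Orb Λ)) :
    ((creation (orb j σ) * annihilation (orb l σ) * hopFactor p j l σ) *ᵥ f) s = 0 := by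
  have hne : orb j σ ≠ orb l σ := EtaPairingODLRO.orb_ne_orb_of_ne hjl σ σ
  rw [← mulVec_mulVec, ← mulVec_mulVec, EtaPairingODLRO.creation_mulVec_apply]
  by_cases hj : orb j σ ∈ s
  · rw [if_pos hj, annihilation_mulVec_apply]
    by_cases hl : orb l σ ∉ s.erase (orb j σ)
    · rw [if_pos hl, hopFactor_eq_diagonal, mulVec_diagonal]
      set u := insert (orb l σ) (s.erase (orb j σ)) with hu
      by_cases hfu : f u = 0
      · rw [hfu, mul_zero, mul_zero, mul_zero]
      · have hpu : IsPaired u := by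
          by_contra h
          exact hfu (hf u h)
        have hlu : orb l (flipSpin σ) ∈ u := (hpu.mem_flip_iff l σ).2 (Finset.mem_insert_self _ _)
        have hju : orb j (flipSpin σ) ∉ u := fun h => by
          have h' := (hpu.mem_flip_iff j σ).1 h
          rw [hu, Finset.mem_insert] at h'
          rcases h' with h' | h'
          · exact hne h'
          · exact Finset.notMem_erase _ _ h'
        rw [occ_of_mem hlu, occ_of_not_mem hju, ht]
        push_cast
        ring
    · rw [if_neg hl, mul_zero]
  · rw [if_neg hj]

/-- The reversed correlated hop kills paired vectors. [cite: deBoerKorepinSchadschneider1995, eq. (5)] -/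
theorem hopTerm'_mulVec_apply_of_paired (p : Params) {j l : Λ} (hjl : j ≠ l) (ht : p.X = p.t)
    (σ : Fin 2) {f : Fock (Orb Λ)} (hf : ∀ s, ¬IsPaired s → f s = 0) (s : Finset (Orb Λ)) :
    ((creation (orb l σ) * annihilation (orb j σ) * hopFactor p j l σ) *ᵥ f) s = 0 := by
  rw [hopFactor_comm]
  exact hopTerm_mulVec_apply_of_paired p hjl.symm ht σ hf s

/-- **The spin flip kills paired vectors** (it needs singly occupied sites). [cite: deBoerSchadschneider1995, eq. (2)] -/
theorem flipTerm_mulVec_apply_of_paired {j l : Λ} (hjl : j ≠ l) {f : Fock (Orb Λ)}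
    (hf : ∀ s, ¬IsPaired s → f s = 0) (s : Finset (Orb Λ)) :
    ((fermionSpinPlus j * fermionSpinMinus l) *ᵥ f) s = 0 := by
  have hjl' := EtaPairingODLRO.orb_ne_orb_of_ne hjl
  have h01 := EtaPairingODLRO.orb_zero_ne_orb_one (Λ := Λ)
  have hexp : (fermionSpinPlus j * fermionSpinMinus l) *ᵥ f =
      creation (orb j 0) *ᵥ (annihilation (orb j 1) *ᵥ
        (creation (orb l 1) *ᵥ (annihilation (orb l 0) *ᵥ f))) := by
    simp only [fermionSpinPlus, fermionSpinMinus, mul_assoc, mulVec_mulVec]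
  rw [hexp, EtaPairingODLRO.creation_mulVec_apply]
  by_cases h1 : orb j 0 ∈ s
  swap
  · rw [if_neg h1]
  rw [if_pos h1, annihilation_mulVec_apply]
  by_cases h2 : orb j 1 ∉ s.erase (orb j 0)
  swap
  · rw [if_neg h2, mul_zero]
  rw [if_pos h2, EtaPairingODLRO.creation_mulVec_apply]
  by_cases h3 : orb l 1 ∈ insert (orb j 1) (s.erase (orb j 0))
  swap
  · rw [if_neg h3, mul_zero, mul_zero]
  rw [if_pos h3, annihilation_mulVec_apply]
  by_cases h4 : orb l 0 ∉ (insert (orb j 1) (s.erase (orb j 0))).erase (orb l 1)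
  swap
  · rw [if_neg h4, mul_zero, mul_zero, mul_zero]
  rw [if_pos h4]
  set w := insert (orb l 0) ((insert (orb j 1) (s.erase (orb j 0))).erase (orb l 1)) with hw_def
  have hw : ¬IsPaired w := fun hw => by
    have hj1 : orb j 1 ∈ w :=
      Finset.mem_insert_of_mem (Finset.mem_erase.2 ⟨hjl' 1 1, Finset.mem_insert_self _ _⟩)
    have hj0 : orb j 0 ∉ w := by
      intro h
      rw [hw_def, Finset.mem_insert] at h
      rcases h with h | h
      · exact hjl' 0 0 h
      · have h' := Finset.mem_of_mem_erase h
        rw [Finset.mem_insert] at h'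
        rcases h' with h' | h'
        · exact h01 j h'
        · exact Finset.notMem_erase _ _ h'
    exact hj0 ((hw j).2 hj1)
  rw [hf w hw, mul_zero, mul_zero, mul_zero, mul_zero]

/-- **The pair hop on amplitudes** (sign-free, tree `pairCreation_mulVec_apply`,
`pairAnnihilation_mulVec_apply`): `(c†_{j↑}c†_{j↓}c_{l↓}c_{l↑} f)(s) = [j↑,j↓ ∈ s][l↑,l↓ ∉ s∖j] f(s ∖ j ∪ l)`.
[cite: Tasaki2020, §9.2] -/
theorem pairTerm_mulVec_apply (j l : Λ) (f : Fock (Orb Λ)) (s : Finset (Orb Λ)) :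
    ((pairCre j * pairAnn l) *ᵥ f) s =
      if orb j 0 ∈ s ∧ orb j 1 ∈ s then
        (if orb l 0 ∉ (s.erase (orb j 0)).erase (orb j 1) ∧ orb l 1 ∉ (s.erase (orb j 0)).erase (orb j 1)
          then f (insert (orb l 0) (insert (orb l 1) ((s.erase (orb j 0)).erase (orb j 1)))) else 0)
      else 0 := by
  rw [pairCre, pairAnn, ← mulVec_mulVec, EtaPairingODLRO.pairCreation_mulVec_apply]
  by_cases h : orb j 0 ∈ s ∧ orb j 1 ∈ s
  · rw [if_pos h, if_pos h, EtaPairingODLRO.pairAnnihilation_mulVec_apply]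
  · rw [if_neg h, if_neg h]

/-- The pair hop preserves the support on paired configurations: on an unpaired row it reads an
unpaired configuration. [cite: deBoerSchadschneider1995, eq. (8) and before eq. (9)] -/
theorem pairTerm_mulVec_apply_of_not_isPaired {j l : Λ} (hjl : j ≠ l) {f : Fock (Orb Λ)}
    (hf : ∀ s, ¬IsPaired s → f s = 0) {s : Finset (Orb Λ)} (hs : ¬IsPaired s) :
    ((pairCre j * pairAnn l) *ᵥ f) s = 0 := by
  have hjl' := EtaPairingODLRO.orb_ne_orb_of_ne hjl
  have hlj' := EtaPairingODLRO.orb_ne_orb_of_ne hjl.symm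
  rw [pairTerm_mulVec_apply]
  by_cases hj : orb j 0 ∈ s ∧ orb j 1 ∈ s
  swap
  · rw [if_neg hj]
  rw [if_pos hj]
  by_cases hl : orb l 0 ∉ (s.erase (orb j 0)).erase (orb j 1) ∧ orb l 1 ∉ (s.erase (orb j 0)).erase (orb j 1)
  swap
  · rw [if_neg hl]
  rw [if_pos hl]
  have hl0 : orb l 0 ∉ s := fun h =>
    hl.1 (Finset.mem_erase.2 ⟨hlj' 0 1, Finset.mem_erase.2 ⟨hlj' 0 0, h⟩⟩)
  have hl1 : orb l 1 ∉ s := fun h =>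
    hl.2 (Finset.mem_erase.2 ⟨hlj' 1 1, Finset.mem_erase.2 ⟨hlj' 1 0, h⟩⟩)
  refine hf _ fun hw => hs fun x => ?_
  by_cases hxj : x = j
  · subst hxj; exact ⟨fun _ => hj.2, fun _ => hj.1⟩
  by_cases hxl : x = l
  · subst hxl; exact ⟨fun h => (hl0 h).elim, fun h => (hl1 h).elim⟩
  have hx : ∀ σ : Fin 2, orb x σ ∈ insert (orb l 0) (insert (orb l 1) ((s.erase (orb j 0)).erase (orb j 1)))
      ↔ orb x σ ∈ s := fun σ => by
    have hxj' := EtaPairingODLRO.orb_ne_orb_of_ne hxj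
    have hxl' := EtaPairingODLRO.orb_ne_orb_of_ne hxl
    simp [Finset.mem_insert, Finset.mem_erase, hxj', hxl']
  rw [← hx 0, ← hx 1]
  exact hw x

/-- The diagonal part on amplitudes. [cite: deBoerSchadschneider1995, eq. (2)] -/
theorem diagOp_mulVec_apply (p : Params) (j l : Λ) (f : Fock (Orb Λ)) (s : Finset (Orb Λ)) :
    (diagOp p j l *ᵥ f) s = ((diagVal p j l s : ℝ) : ℂ) * f s := by
  rw [diagOp_eq_diagonal, mulVec_diagonal]

/-- **The bond Hamiltonian on vectors supported on paired configurations** (`X = t`):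
only the diagonal part and the two pair hops survive. [cite: deBoerKorepinSchadschneider1995, eq. (5)] -/
theorem bondHamiltonian_mulVec_apply_of_paired (p : Params) {j l : Λ} (hjl : j ≠ l) (ht : p.X = p.t)
    {f : Fock (Orb Λ)} (hf : ∀ s, ¬IsPaired s → f s = 0) (s : Finset (Orb Λ)) :
    (bondHamiltonian p j l *ᵥ f) s =
      ((diagVal p j l s : ℝ) : ℂ) * f s + (p.Y : ℂ) * ((pairCre j * pairAnn l) *ᵥ f) s +
        (p.Y : ℂ) * ((pairCre l * pairAnn j) *ᵥ f) s := by
  rw [bondHamiltonian_eq]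
  simp only [add_mulVec, Matrix.sum_mulVec, smul_mulVec, Pi.add_apply, Finset.sum_apply, Pi.smul_apply,
    smul_eq_mul, hopTerm_mulVec_apply_of_paired p hjl ht _ hf, hopTerm'_mulVec_apply_of_paired p hjl ht _ hf,
    flipTerm_mulVec_apply_of_paired hjl hf, flipTerm_mulVec_apply_of_paired hjl.symm hf,
    diagOp_mulVec_apply, add_zero, Finset.sum_const_zero, zero_add, mul_zero]
  ring

/-- **The `η`-pairing states are eigenvectors of every bond Hamiltonian** with the local energy
`E₀ = U/(2Z) + V`: for `X = t`, `μ = 0` and `Y ε_j ε_l = 2V` (momentum `0`: `ε ≡ 1`, `Y = 2V`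
[dBKS eq. (5)–(6), dBS eq. (9)]; momentum `π` on a bipartite bond: `ε_j ε_l = -1`, `Y = -2V`
[dBS eq. (10)]), `h_{jl} (η†_ε)^N |0⟩ = E₀ (η†_ε)^N |0⟩` — the local states `|00⟩, |22⟩,
|20⟩ ± |02⟩` are local eigenstates with the common eigenvalue `E₁ = E₈ = E₆^{(∓)} = U/2Z + V`.
[cite: deBoerSchadschneider1995, eq. (2) and before eq. (9)] -/
theorem bondHamiltonian_mulVec_etaPairingState (p : Params) {j l : Λ} (hjl : j ≠ l) (ht : p.X = p.t)
    (hμ : p.μ = 0) (ε : Λ → ℤˣ) (hY : p.Y * (((ε j : ℤ) * (ε l : ℤ) : ℤ) : ℝ) = 2 * p.V) (N : ℕ) :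
    bondHamiltonian p j l *ᵥ etaPairingState ε N = ((localEnergy p : ℝ) : ℂ) • etaPairingState ε N := by
  have hjl' := EtaPairingODLRO.orb_ne_orb_of_ne hjl
  have hlj' := EtaPairingODLRO.orb_ne_orb_of_ne hjl.symm
  have hf : ∀ s, ¬IsPaired s → etaPairingState ε N s = 0 := fun s hs =>
    etaPairingState_apply_of_not_isPaired ε N hs
  have hY' : (p.Y : ℂ) * (((ε j : ℤ) : ℂ) * ((ε l : ℤ) : ℂ)) = 2 * (p.V : ℂ) := by
    have := congrArg (fun r : ℝ => (r : ℂ)) hY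
    push_cast at this
    exact this
  have hE : ((localEnergy p : ℝ) : ℂ) = (p.U / p.Z : ℝ) / 2 + p.V := by
    unfold localEnergy; push_cast; ring
  funext s
  rw [Pi.smul_apply, smul_eq_mul, bondHamiltonian_mulVec_apply_of_paired p hjl ht hf]
  by_cases hs : IsPaired s
  swap
  · rw [hf s hs, pairTerm_mulVec_apply_of_not_isPaired hjl hf hs,
      pairTerm_mulVec_apply_of_not_isPaired hjl.symm hf hs, mul_zero, mul_zero, add_zero, add_zero, mul_zero]
  obtain ⟨S, rfl⟩ : ∃ S, s = pairConfig S := ⟨_, hs.eq_pairConfig⟩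
  -- the conditions of the two pair moves
  have hcondj : (orb j 0 ∈ pairConfig S ∧ orb j 1 ∈ pairConfig S) ↔ j ∈ S := by
    rw [orb_mem_pairConfig, orb_mem_pairConfig, and_self_iff]
  have hcondl : (orb l 0 ∈ pairConfig S ∧ orb l 1 ∈ pairConfig S) ↔ l ∈ S := by
    rw [orb_mem_pairConfig, orb_mem_pairConfig, and_self_iff]
  have hcondl' : (orb l 0 ∉ ((pairConfig S).erase (orb j 0)).erase (orb j 1) ∧
      orb l 1 ∉ ((pairConfig S).erase (orb j 0)).erase (orb j 1)) ↔ l ∉ S := by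
    simp [Finset.mem_erase, orb_mem_pairConfig, hlj']
  have hcondj' : (orb j 0 ∉ ((pairConfig S).erase (orb l 0)).erase (orb l 1) ∧
      orb j 1 ∉ ((pairConfig S).erase (orb l 0)).erase (orb l 1)) ↔ j ∉ S := by
    simp [Finset.mem_erase, orb_mem_pairConfig, hjl']
  rw [pairTerm_mulVec_apply, pairTerm_mulVec_apply, pairConfig_move hjl, pairConfig_move hjl.symm]
  simp only [hcondj, hcondl, hcondl', hcondj', etaPairingState_apply_pairConfig, diagVal, diagFormula,
    occ_pairConfig, hμ, zero_div, zero_mul, add_zero, hE]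
  by_cases hN : S.card = N
  swap
  · -- wrong particle number: everything vanishes
    by_cases hjS : j ∈ S <;> by_cases hlS : l ∈ S
    · simp [hN, hjS, hlS]
    · have h1 : S.card - 1 + 1 ≠ N := by rwa [Nat.sub_add_cancel (Finset.card_pos.2 ⟨j, hjS⟩)]
      simp [hN, hjS, hlS, h1]
    · have h1 : S.card - 1 + 1 ≠ N := by rwa [Nat.sub_add_cancel (Finset.card_pos.2 ⟨l, hlS⟩)]
      simp [hN, hjS, hlS, h1]
    · simp [hN, hjS, hlS]
  by_cases hjS : j ∈ S <;> by_cases hlS : l ∈ S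
  · simp only [hN, hjS, hlS, if_true, if_false, not_true_eq_false]
    push_cast
    ring
  · have hc : (insert l (S.erase j)).card = N := by
      rw [Finset.card_insert_of_notMem (fun h => hlS (Finset.mem_of_mem_erase h)),
        Finset.card_erase_add_one hjS, hN]
    simp only [hN, hjS, hlS, hc, if_true, if_false, not_true_eq_false, not_false_eq_true,
      prod_sign_insert_erase ε hjS hlS]
    push_cast
    linear_combination ((N.factorial : ℂ) * ∏ x ∈ S, ((ε x : ℤ) : ℂ)) * hY'
  · have hc : (insert j (S.erase l)).card = N := by
      rw [Finset.card_insert_of_notMem (fun h => hjS (Finset.mem_of_mem_erase h)),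
        Finset.card_erase_add_one hlS, hN]
    simp only [hN, hjS, hlS, hc, if_true, if_false, not_true_eq_false, not_false_eq_true,
      prod_sign_insert_erase ε hlS hjS]
    push_cast
    linear_combination ((N.factorial : ℂ) * ∏ x ∈ S, ((ε x : ℤ) : ℂ)) * hY'
  · simp only [hN, hjS, hlS, if_true, if_false, not_false_eq_true]
    push_cast
    ring

end EtaPairing

/-! ## §6 Assembly: the optimal-ground-state theorem for the `η`-pairing states, and their ODLRO -/

section Assembly

variable {Λ : Type*} [LinearOrder Λ] [Fintype Λ] (G : SimpleGraph Λ) [DecidableRel G.Adj]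

/-- Counting the bonds: `Σ_{j<l, j∼l} v = #bonds · v`. [cite: deBoerSchadschneider1995, eq. (1)] -/
theorem sum_sum_ite_bond {M : Type*} [AddCommMonoid M] (v : M) :
    (∑ j : Λ, ∑ l : Λ, if j < l ∧ G.Adj j l then v else 0) = bondCount G • v := by
  rw [bondCount, ← Finset.sum_product' (f := fun j l => if j < l ∧ G.Adj j l then v else 0),
    Finset.univ_product_univ, ← Finset.sum_filter, Finset.sum_const]

/-- **`H (η†_ε)^N |0⟩ = #bonds · E₀ · (η†_ε)^N |0⟩`** (`X = t`, `μ = 0`, `Y ε_j ε_l = 2V` on every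
bond; de Boer–Korepin–Schadschneider's eigenvalue `E_N`, eq. (6), at `P = Q = μ = 0`).
[cite: deBoerKorepinSchadschneider1995, eqs. (5)–(6)] -/
theorem hamiltonian_mulVec_etaPairingState (p : Params) (ht : p.X = p.t) (hμ : p.μ = 0) (ε : Λ → ℤˣ)
    (hY : ∀ j l, G.Adj j l → p.Y * (((ε j : ℤ) * (ε l : ℤ) : ℤ) : ℝ) = 2 * p.V) (N : ℕ) :
    hamiltonian G p *ᵥ etaPairingState ε N =
      ((bondCount G * localEnergy p : ℝ) : ℂ) • etaPairingState ε N := by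
  unfold hamiltonian
  rw [Matrix.sum_mulVec]
  have h1 : ∀ j, (∑ l, if j < l ∧ G.Adj j l then bondHamiltonian p j l else 0) *ᵥ etaPairingState ε N =
      ∑ l, if j < l ∧ G.Adj j l then ((localEnergy p : ℝ) : ℂ) • etaPairingState ε N else 0 := by
    intro j
    rw [Matrix.sum_mulVec]
    refine Finset.sum_congr rfl fun l _ => ?_
    split_ifs with h
    · exact bondHamiltonian_mulVec_etaPairingState p h.1.ne ht hμ ε (hY j l h.2) N
    · exact zero_mulVec _
  simp_rw [h1]
  rw [sum_sum_ite_bond, ← Nat.cast_smul_eq_nsmul ℂ, smul_smul]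
  push_cast
  rfl

/-- **The bond Hamiltonian is bounded below by its local energy** in the `η`-pairing regime
(`X = t`, `μ = 0`, `|Y| ≤ -2V`, inequalities (9)): `E₀ ‖φ‖² ≤ Re ⟨φ, h_{jl} φ⟩` for EVERY
vector `φ` — the operator inequality `h_{jl} ≥ E₀` of the optimal-ground-state method.
[cite: deBoerSchadschneider1995, eq. (9)] -/
theorem bondHamiltonian_re_expect_ge (p : Params) (hI : OGSInequalities p) (ht : p.X = p.t)
    (hY : |p.Y| ≤ -(2 * p.V)) (hμ : p.μ = 0) {j l : Λ} (hjl : j ≠ l) (φ : Fock (Orb Λ)) :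
    localEnergy p * ∑ a, ‖φ a‖ ^ 2 ≤ (star φ ⬝ᵥ (bondHamiltonian p j l *ᵥ φ)).re :=
  re_quadForm_ge_of_gershgorin_ge (bondHamiltonian_isHermitian p j l) (fun α => by
    rw [bondHamiltonian_apply_self p hjl, Complex.ofReal_re]
    have h1 := localGershgorin_ge p hI ht hY hμ j l α
    have h2 := bondHamiltonian_colOff_le p hjl α
    unfold colOff at h2
    linarith) φ

/-- **The generalized Hubbard Hamiltonian is bounded below by `#bonds · E₀`** in the `η`-pairing
regime: `#bonds · E₀ · ‖φ‖² ≤ Re ⟨φ, H φ⟩` for every `φ` (Gerschgorin bound of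
de Boer–Korepin–Schadschneider, eq. (7), summed over the bonds).
[cite: deBoerKorepinSchadschneider1995, eqs. (7)–(8)] -/
theorem hamiltonian_re_expect_ge (p : Params) (hI : OGSInequalities p) (ht : p.X = p.t)
    (hY : ∀ j l, G.Adj j l → |p.Y| ≤ -(2 * p.V)) (hμ : p.μ = 0) (φ : Fock (Orb Λ)) :
    bondCount G * localEnergy p * ∑ a, ‖φ a‖ ^ 2 ≤ (star φ ⬝ᵥ (hamiltonian G p *ᵥ φ)).re := by
  have hterm : ∀ j l : Λ, (if j < l ∧ G.Adj j l then localEnergy p * ∑ a, ‖φ a‖ ^ 2 else 0) ≤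
      (star φ ⬝ᵥ ((if j < l ∧ G.Adj j l then bondHamiltonian p j l else 0) *ᵥ φ)).re := by
    intro j l
    split_ifs with h
    · exact bondHamiltonian_re_expect_ge p hI ht (hY j l h.2) hμ h.1.ne φ
    · simp [zero_mulVec]
  have hsum := Finset.sum_le_sum fun j (_ : j ∈ (univ : Finset Λ)) =>
    Finset.sum_le_sum fun l (_ : l ∈ (univ : Finset Λ)) => hterm j l
  rw [sum_sum_ite_bond, nsmul_eq_mul, ← mul_assoc] at hsum
  refine hsum.trans (le_of_eq ?_)
  unfold hamiltonian
  rw [Matrix.sum_mulVec, dotProduct_sum, Complex.re_sum]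
  refine Finset.sum_congr rfl fun j _ => ?_
  rw [Matrix.sum_mulVec, dotProduct_sum, Complex.re_sum]

/-- **THE OPTIMAL-GROUND-STATE THEOREM FOR THE `η`-PAIRING STATES** (de Boer–Korepin–Schadschneider,
PRL 74 (1995) 789, eq. (8) at `P = Q = h = 0`; de Boer–Schadschneider, PRL 75 (1995) 4298,
eqs. (9)–(10) at `t = X`). Let `G` be any finite simple graph (any dimension, any lattice),
`t = X`, `μ = 0`, `V ≤ 0`, `-U/Z ≥ 2|t| + 2V`, `-U/Z ≥ V - J_z/4`, `-U/Z ≥ V + |J_xy|/2 + J_z/4`,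
and let `ε : Λ → ℤˣ` be a sign function with `Y ε_j ε_l = 2V` on every bond (`ε ≡ 1` and
`Y = 2V`: momentum-`0` pairs; `ε` a bipartite colouring and `Y = -2V`: momentum-`π` pairs). Then for
every `N ≤ |Λ|` the `η`-pairing state `(η†_ε)^N |0⟩` is a ground state of the generalized Hubbard
Hamiltonian `H = Σ_{⟨jl⟩} h_{jl}` in the `2N`-particle sector, and the sector ground-state energy is
`#bonds · (U/(2Z) + V)` — independent of `N` (the whole `η`-multiplet is degenerate).
[cite: deBoerSchadschneider1995, eq. (9)] [cite: deBoerKorepinSchadschneider1995, eq. (8)] -/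
theorem etaPairing_isGroundState (p : Params) (hI : OGSInequalities p) (ht : p.X = p.t)
    (hμ : p.μ = 0) (ε : Λ → ℤˣ)
    (hY : ∀ j l, G.Adj j l → p.Y * (((ε j : ℤ) * (ε l : ℤ) : ℤ) : ℝ) = 2 * p.V)
    {N : ℕ} (hN : N ≤ Fintype.card Λ) :
    IsGroundState (hamiltonian G p) (2 * N) (etaPairingState ε N) ∧
      groundEnergy (hamiltonian G p) (2 * N) = bondCount G * localEnergy p := by
  set H := hamiltonian G p with hH
  set ψ := etaPairingState ε N with hψ
  set E : ℝ := bondCount G * localEnergy p with hE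
  have hYabs : ∀ j l, G.Adj j l → |p.Y| ≤ -(2 * p.V) := fun j l h => by
    have h1 := congrArg abs (hY j l h)
    have hε : |(((ε j : ℤ) * (ε l : ℤ) : ℤ) : ℝ)| = 1 := by
      rw [← Int.cast_abs, abs_mul, Int.abs_eq_natAbs, Int.abs_eq_natAbs, Int.units_natAbs,
        Int.units_natAbs]
      norm_num
    rw [abs_mul, hε, mul_one] at h1
    rw [h1, abs_of_nonpos (by linarith [hI.hV])]
  have hHψ : H *ᵥ ψ = (E : ℂ) • ψ := hamiltonian_mulVec_etaPairingState G p ht hμ ε hY N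
  have hψN : IsNParticle (2 * N) ψ := isNParticle_etaRaise_pow_mulVec_vacuum ε N
  have hψ0 : ψ ≠ 0 := etaRaise_pow_mulVec_vacuum_ne_zero ε hN
  -- upper bound: the variational principle at ψ
  have hpos : 0 < (star ψ ⬝ᵥ ψ).re := by
    rw [re_star_dotProduct_self_eq_sum_sq]
    obtain ⟨s, hs⟩ : ∃ s, ψ s ≠ 0 := Function.ne_iff.1 hψ0
    exact lt_of_lt_of_le (by positivity) (Finset.single_le_sum (fun a _ => sq_nonneg ‖ψ a‖) (mem_univ s))
  have hle : groundEnergy H (2 * N) ≤ E := by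
    have h := LiebThm1.groundEnergy_mul_norm_le H hψN
    rw [expect, hHψ, dotProduct_smul, smul_eq_mul, Complex.re_ofReal_mul] at h
    exact le_of_mul_le_mul_right h hpos
  -- lower bound: the Gerschgorin operator inequality
  have h2N : 2 * N ≤ Fintype.card (Orb Λ) := by rw [card_orb]; omega
  have hge : E ≤ groundEnergy H (2 * N) := by
    refine le_csInf (ThermodynamicLimit.groundEnergySet_nonempty H h2N) ?_
    rintro e ⟨φ, -, hφ1, rfl⟩
    have h := hamiltonian_re_expect_ge G p hI ht hYabs hμ φ
    rw [← re_star_dotProduct_self_eq_sum_sq, hφ1, Complex.one_re, mul_one] at h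
    exact h
  have heq : groundEnergy H (2 * N) = E := le_antisymm hle hge
  exact ⟨⟨hψN, hψ0, by rw [heq, hHψ]⟩, heq⟩

/-- **ODLRO of the `η`-pairing ground states** (de Boer–Korepin–Schadschneider, PRL 74 (1995)
789, eq. (4): `⟨ψ_N| c†c† c c |ψ_N⟩ → (N/L)(1 - N/L)`; finite-volume value = Yang's
`ε_x ε_y N(M-N)/(M(M-1))`, tree `pairAmplitude_etaPairingState`): under the hypotheses of
`etaPairing_isGroundState` the `2N`-particle ground state `ψ_N = (η†_ε)^N |0⟩` has the
DISTANCE-INDEPENDENT pair amplitude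
`⟨ψ_N, c†_{x↑} c†_{x↓} c_{y↓} c_{y↑} ψ_N⟩ = ε_x ε_y · N(M-N)/(M(M-1)) · ‖ψ_N‖²` for all `x ≠ y`
(`M = |Λ|`): off-diagonal long-range order of the superconducting type in a ground state of an
interacting lattice-fermion model, in every dimension. [cite: deBoerKorepinSchadschneider1995, eq. (4)] -/
theorem etaPairing_groundState_ODLRO (p : Params) (hI : OGSInequalities p) (ht : p.X = p.t)
    (hμ : p.μ = 0) (ε : Λ → ℤˣ)
    (hY : ∀ j l, G.Adj j l → p.Y * (((ε j : ℤ) * (ε l : ℤ) : ℤ) : ℝ) = 2 * p.V)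
    {N : ℕ} (hN : N ≤ Fintype.card Λ) {x y : Λ} (hxy : x ≠ y) :
    IsGroundState (hamiltonian G p) (2 * N) (etaPairingState ε N) ∧
      pairAmplitude x y (etaPairingState ε N) =
        (((ε x : ℤ) * (ε y : ℤ) * yangPairAmplitude (Fintype.card Λ) N : ℝ) : ℂ) *
          (star (etaPairingState ε N) ⬝ᵥ etaPairingState ε N) :=
  ⟨(etaPairing_isGroundState G p hI ht hμ ε hY hN).1, pairAmplitude_etaPairingState ε N hxy⟩

/-- **Momentum-zero specialisation** (`ε ≡ 1`, `Y = 2V`; de Boer–Schadschneider eq. (9)): the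
`η`-pairing state `(η†)^N|0⟩`, `η† = Σ_x c†_{x↑} c†_{x↓}`, is a ground state with POSITIVE uniform
pair amplitude `N(M-N)/(M(M-1)) ‖ψ‖²`. [cite: deBoerSchadschneider1995, eq. (9)] -/
theorem etaPairing_isGroundState_momentumZero (p : Params) (hI : OGSInequalities p) (ht : p.X = p.t)
    (hμ : p.μ = 0) (hY : p.Y = 2 * p.V) {N : ℕ} (hN : N ≤ Fintype.card Λ) {x y : Λ} (hxy : x ≠ y) :
    IsGroundState (hamiltonian G p) (2 * N) (etaPairingState (fun _ => 1) N) ∧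
      groundEnergy (hamiltonian G p) (2 * N) = bondCount G * localEnergy p ∧
      pairAmplitude x y (etaPairingState (fun _ => 1) N) =
        ((yangPairAmplitude (Fintype.card Λ) N : ℝ) : ℂ) *
          (star (etaPairingState (fun _ : Λ => (1 : ℤˣ)) N) ⬝ᵥ etaPairingState (fun _ => 1) N) := by
  have hY' : ∀ j l : Λ, G.Adj j l →
      p.Y * ((((fun _ : Λ => (1 : ℤˣ)) j : ℤ) * ((fun _ : Λ => (1 : ℤˣ)) l : ℤ) : ℤ) : ℝ) = 2 * p.V := by
    intro j l _; simpa using hY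
  obtain ⟨h1, h2⟩ := etaPairing_isGroundState G p hI ht hμ (fun _ => 1) hY' hN
  refine ⟨h1, h2, ?_⟩
  rw [pairAmplitude_etaPairingState (fun _ => 1) N hxy]
  simp

/-- **Momentum-`π` specialisation** (bipartite colouring `ε`, `ε_j ε_l = -1` on every bond,
`Y = -2V`; de Boer–Schadschneider eq. (10) at `t = X`): the staggered `η`-pairing state
`(η†_π)^N|0⟩` is a ground state with the staggered pair amplitude
`ε_x ε_y N(M-N)/(M(M-1)) ‖ψ‖²` (Yang's states on a bipartite lattice).
[cite: deBoerSchadschneider1995, eq. (10)] -/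
theorem etaPairing_isGroundState_momentumPi (p : Params) (hI : OGSInequalities p) (ht : p.X = p.t)
    (hμ : p.μ = 0) (hY : p.Y = -(2 * p.V)) (ε : Λ → ℤˣ) (hε : ∀ j l, G.Adj j l → ε j * ε l = -1)
    {N : ℕ} (hN : N ≤ Fintype.card Λ) :
    IsGroundState (hamiltonian G p) (2 * N) (etaPairingState ε N) ∧
      groundEnergy (hamiltonian G p) (2 * N) = bondCount G * localEnergy p := by
  refine etaPairing_isGroundState G p hI ht hμ ε (fun j l h => ?_) hN
  rw [← Units.val_mul, hε j l h]
  push_cast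
  rw [hY]; ring

/-! ### The physical readings: on-site interaction on a regular graph, chemical potential -/

/-- The sum over bonds of the shared on-site terms is the on-site sum weighted by the degree:
`Σ_{j<l, j∼l} (A_j + A_l) = Σ_x deg(x) A_x`. [cite: deBoerSchadschneider1995, eq. (1)] -/
theorem sum_bond_add_eq_sum_degree {M : Type*} [AddCommMonoid M] (A : Λ → M) :
    (∑ j : Λ, ∑ l : Λ, if j < l ∧ G.Adj j l then A j + A l else 0) = ∑ x : Λ, G.degree x • A x := by
  classical
  -- symmetrise: the ordered-pair sum counts every bond twice
  have hsym : (∑ j : Λ, ∑ l : Λ, if j < l ∧ G.Adj j l then A j + A l else 0) =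
      ∑ j : Λ, ∑ l : Λ, if G.Adj j l then A j else 0 := by
    have h1 : (∑ j : Λ, ∑ l : Λ, if j < l ∧ G.Adj j l then A j + A l else 0) =
        (∑ j : Λ, ∑ l : Λ, if j < l ∧ G.Adj j l then A j else 0) +
          ∑ j : Λ, ∑ l : Λ, if j < l ∧ G.Adj j l then A l else 0 := by
      rw [← Finset.sum_add_distrib]
      refine Finset.sum_congr rfl fun j _ => ?_
      rw [← Finset.sum_add_distrib]
      refine Finset.sum_congr rfl fun l _ => ?_
      split_ifs <;> simp
    have h2 : (∑ j : Λ, ∑ l : Λ, if j < l ∧ G.Adj j l then A l else 0) =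
        ∑ j : Λ, ∑ l : Λ, if l < j ∧ G.Adj j l then A j else 0 := by
      rw [Finset.sum_comm]
      refine Finset.sum_congr rfl fun j _ => Finset.sum_congr rfl fun l _ => ?_
      simp only [G.adj_comm]
    rw [h1, h2, ← Finset.sum_add_distrib]
    refine Finset.sum_congr rfl fun j _ => ?_
    rw [← Finset.sum_add_distrib]
    refine Finset.sum_congr rfl fun l _ => ?_
    by_cases h : G.Adj j l
    · have hne : j ≠ l := G.ne_of_adj h
      rcases lt_or_gt_of_ne hne with hlt | hgt
      · simp [h, hlt, not_lt.2 hlt.le]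
      · simp [h, hgt, not_lt.2 hgt.le]
    · simp [h]
  rw [hsym]
  refine Finset.sum_congr rfl fun j _ => ?_
  rw [← Finset.sum_filter, Finset.sum_const, ← SimpleGraph.card_neighborFinset_eq_degree,
    SimpleGraph.neighborFinset_eq_filter]

/-- **On a `Z`-regular graph the shared on-site terms of `H` add up to the Hubbard interaction**
`U Σ_x (n_{x↑} - ½)(n_{x↓} - ½)` (and likewise `(μ/Z) Σ_bonds (n_j + n_l) = μ N̂`): this is why
de Boer–Schadschneider write `U/Z`, `μ/Z` in the bond Hamiltonian.
[cite: deBoerSchadschneider1995, eq. (1)] -/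
theorem sum_bond_onSite_eq (p : Params) {Z : ℕ} (hZ : G.IsRegularOfDegree Z) (hpZ : p.Z = Z)
    (hZ0 : Z ≠ 0) :
    (∑ j : Λ, ∑ l : Λ, if j < l ∧ G.Adj j l then
        ((p.U / p.Z : ℝ) : ℂ) • (onSiteQ j + onSiteQ l) else 0) = (p.U : ℂ) • ∑ x : Λ, onSiteQ x := by
  have h := sum_bond_add_eq_sum_degree G (fun x => ((p.U / p.Z : ℝ) : ℂ) • onSiteQ x)
  simp only [← smul_add] at h
  rw [h, Finset.smul_sum]
  refine Finset.sum_congr rfl fun x _ => ?_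
  rw [hZ.degree_eq x, ← Nat.cast_smul_eq_nsmul ℂ, smul_smul, hpZ]
  congr 1
  have hZ' : (Z : ℂ) ≠ 0 := Nat.cast_ne_zero.2 hZ0
  push_cast
  field_simp

/-- **Chemical potential.** On a `Z`-regular graph the `μ`-terms of `H` add up to `μ N̂`, which is
the constant `μ · 2N` on the `2N`-particle sector; hence the `η`-pairing states remain sector ground
states for every `μ` (de Boer–Schadschneider: "if a state is a ground state of `H` at some fixed
particle number `N`, then it is also a ground state of `H + μN`"). Stated operator-free: for every
`2N`-particle `φ` and the `μ = 0` Hamiltonian `H₀`,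
`Re ⟨φ, (H₀ + μ' N̂) φ⟩ = Re ⟨φ, H₀ φ⟩ + μ' · 2N ‖φ‖²`. [cite: deBoerSchadschneider1995, after eq. (16)] -/
theorem re_expect_add_chemicalPotential (H₀ : Matrix (Finset (Orb Λ)) (Finset (Orb Λ)) ℂ) (μ' : ℝ)
    {n : ℕ} {φ : Fock (Orb Λ)} (hφ : IsNParticle n φ) :
    (star φ ⬝ᵥ ((H₀ + (μ' : ℂ) • (totalNumber : Matrix (Finset (Orb Λ)) (Finset (Orb Λ)) ℂ)) *ᵥ φ)).re =
      (star φ ⬝ᵥ (H₀ *ᵥ φ)).re + μ' * n * (star φ ⬝ᵥ φ).re := by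
  have hNφ := totalNumber_mulVec_of_isNParticle hφ
  rw [add_mulVec, smul_mulVec, hNφ, dotProduct_add, dotProduct_smul, dotProduct_smul, smul_eq_mul,
    smul_eq_mul, Complex.add_re]
  congr 1
  rw [← mul_assoc, show (μ' : ℂ) * (n : ℂ) = ((μ' * n : ℝ) : ℂ) by push_cast; ring, Complex.re_ofReal_mul]

end Assembly

end GenHubbard

end Literature.MathematicalPhysics.QuantumLattice
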